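import Literature.Analysis.FluidPDE.CLAmplitudes
import Literature.Analysis.FunctionSpaces.TorusFourierCalculus
import Literature.Analysis.FunctionSpaces.TorusEnstrophyOrthogonality
import HarnessLib

/-!
# Amplitudes for the intermittent-jet scheme: an algebraic stress cut-off and the squared
  amplitudes as affine functions of `(ρ, R)`

Analysis/FluidPDE support file (everything proved) for the amplitude functions of the
intermittent convex-integration scheme of Buckmaster–Vicol (EMS Surv. Math. Sci. 6 (2019), §7.5.1
(7.25)–(7.30): `a_ξ = ρ^{1/2} γ_ξ(Id - R̊_ℓ/ρ)`, `∑_ξ a_ξ² ξ ⊗ ξ = ρ Id - R̊_ℓ`), in a form whose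
derivatives are elementary to control along an iteration. With the direction family and the affine
squared coefficients `Γ_x(M)²` of the tree's geometric lemma (`NashGeometricLemma`, Cheskidov–Luo 2022,
Lemma 4.2) we take, for a stress field `R` (by columns) and a floor `γ₀ > 0`,

* `rho γ₀ R t y = (2/r_d) √(γ₀² + |R(t,y)|_F²)` — an ALGEBRAIC smooth majorant of `|R|_F` with
  `ρ ≥ 2γ₀/r_d`, `|R_{ij}| ≤ (r_d/2) ρ`, `ρ ≤ (2/r_d)(γ₀ + |R|_F)` (replacing the cut-off profiles of
  CL22 §4.3 / BV (7.27), whose only role is to produce such a `ρ`);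
* `nmat γ₀ R t y = Id - R(t,y)/ρ(t,y)` (`∈ B̄(Id, r_d/2)`), `hsq γ₀ R x t y = ρ Γ_x(Id - R/ρ)²` and the
  amplitude `jamp γ₀ R x = √hsq`.

Since `Γ_x²` is affine, `hsq` is an explicit affine combination `α_x ρ + β_x R_{ij}` of `ρ` and ONE
entry of `R` (`hsq_inl`, `hsq_inr_inl`, `hsq_inr_inr`), with `3γ₀/8 ≤ hsq ≤ ρ`; and the key identity
`∑_x hsq_x (k_x)_a (k_x)_b = ρ δ_ab - R_ba` holds for symmetric `R(t,y)` (`sum_hsq_mul_dir`). Joint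
smoothness of `ρ`, `hsq`, `jamp` on any time set where `R` is jointly smooth.

## References

* T. Buckmaster, V. Vicol, EMS Surv. Math. Sci. 6 (2019) = arXiv:1901.09023, §7.5.1 (7.25)–(7.30). [`BuckmasterVicol2020`]
* A. Cheskidov, X. Luo, arXiv:2009.06596, Lemma 4.2, §4.4 (4.15). [`CheskidovLuo2022`]
-/

noncomputable section

open Set Metric Finset
open scoped ContDiff

namespace Literature.Analysis.FluidPDE

namespace JAmp

open Literature.Analysis.FunctionSpaces NashGeometric CL22

variable {d : Type*} [Fintype d] [DecidableEq d]

/-! ## Definitions -/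

section Defs

variable (γ₀ : ℝ) (R : ℝ → UnitAddTorus d → d → EuclideanSpace ℝ d)

/-- **The algebraic stress cut-off** `ρ(t,y) = (2/r_d) √(γ₀² + |R(t,y)|_F²)`. [cite: BuckmasterVicol2020, §7.5.1 (7.27)] -/
def rho (t : ℝ) (y : UnitAddTorus d) : ℝ := (2 / radius d) * Real.sqrt (γ₀ ^ 2 + frobSq R t y)

/-- The matrix `Id - R(t,y)/ρ(t,y)` (entry `(i, j)` uses `R t y j i`). [cite: BuckmasterVicol2020, §7.5.1 (7.25)] -/
def nmat (t : ℝ) (y : UnitAddTorus d) : d → d → ℝ :=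
  fun i j => (idMat : d → d → ℝ) i j - R t y j i / rho γ₀ R t y

/-- **The squared amplitude** `hsq_x = ρ Γ_x(Id - R/ρ)²`. [cite: BuckmasterVicol2020, §7.5.1 (7.25)] -/
def hsq (x : Index d) (t : ℝ) (y : UnitAddTorus d) : ℝ := rho γ₀ R t y * coeffSq (nmat γ₀ R t y) x

/-- **The amplitude** `a_x = √hsq_x = ρ^{1/2} Γ_x(Id - R/ρ)`. [cite: BuckmasterVicol2020, §7.5.1 (7.25)] -/
def jamp (x : Index d) (t : ℝ) (y : UnitAddTorus d) : ℝ := Real.sqrt (hsq γ₀ R x t y)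

end Defs

variable {γ₀ : ℝ} {R : ℝ → UnitAddTorus d → d → EuclideanSpace ℝ d}

/-! ## Pointwise facts -/

section Pointwise

variable (hd : 2 ≤ Fintype.card d) (hγ : 0 < γ₀)
include hd hγ

omit [DecidableEq d] hd in
/-- `√(γ₀² + |R|_F²) > 0`. [folklore] -/
theorem sqrt_pos (t : ℝ) (y : UnitAddTorus d) : 0 < Real.sqrt (γ₀ ^ 2 + frobSq R t y) :=
  Real.sqrt_pos.2 (by have := frobSq_nonneg (R := R) t y; positivity)

omit [DecidableEq d] hd in
/-- `γ₀ ≤ √(γ₀² + |R|_F²)` and `|R|_F ≤ √(γ₀² + |R|_F²)`. [folklore] -/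
theorem le_sqrt (t : ℝ) (y : UnitAddTorus d) :
    γ₀ ≤ Real.sqrt (γ₀ ^ 2 + frobSq R t y) ∧ Real.sqrt (frobSq R t y) ≤ Real.sqrt (γ₀ ^ 2 + frobSq R t y) := by
  have h0 := frobSq_nonneg (R := R) t y
  refine ⟨?_, Real.sqrt_le_sqrt (by nlinarith)⟩
  calc γ₀ = Real.sqrt (γ₀ ^ 2) := (Real.sqrt_sq hγ.le).symm
    _ ≤ _ := Real.sqrt_le_sqrt (by linarith)

omit [DecidableEq d] in
/-- `ρ > 0`. [folklore] -/
theorem rho_pos (t : ℝ) (y : UnitAddTorus d) : 0 < rho γ₀ R t y := by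
  unfold rho; exact mul_pos (div_pos two_pos (radius_pos hd)) (sqrt_pos hγ t y)

omit [DecidableEq d] in
/-- **The floor**: `2γ₀/r_d ≤ ρ`. [folklore] -/
theorem le_rho (t : ℝ) (y : UnitAddTorus d) : 2 * γ₀ / radius d ≤ rho γ₀ R t y := by
  have hr := radius_pos hd
  unfold rho
  rw [show 2 * γ₀ / radius d = (2 / radius d) * γ₀ by ring]
  exact mul_le_mul_of_nonneg_left (le_sqrt hγ t y).1 (by positivity)

omit [DecidableEq d] in
/-- `γ₀ ≤ ρ` (since `r_d ≤ 1/5`). [folklore] -/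
theorem gamma_le_rho (t : ℝ) (y : UnitAddTorus d) : γ₀ ≤ rho γ₀ R t y := by
  have hr := radius_pos hd
  have hr' := radius_le hd
  refine le_trans ?_ (le_rho hd hγ t y)
  rw [le_div_iff₀ hr]; nlinarith

omit [DecidableEq d] in
/-- **`|R_{ij}| ≤ (r_d/2) ρ`**. [folklore] -/
theorem abs_apply_le (t : ℝ) (y : UnitAddTorus d) (i j : d) : |R t y j i| ≤ radius d / 2 * rho γ₀ R t y := by
  have hr := radius_pos hd
  calc |R t y j i| ≤ Real.sqrt (frobSq R t y) := abs_apply_le_sqrt_frobSq t y i j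
    _ ≤ Real.sqrt (γ₀ ^ 2 + frobSq R t y) := (le_sqrt hγ t y).2
    _ = radius d / 2 * rho γ₀ R t y := by unfold rho; field_simp

omit [DecidableEq d] in
/-- `|R_{ij}|/ρ ≤ r_d/2`. [folklore] -/
theorem abs_apply_div_rho_le (t : ℝ) (y : UnitAddTorus d) (i j : d) : |R t y j i / rho γ₀ R t y| ≤ radius d / 2 := by
  have hρ := rho_pos (R := R) hd hγ t y
  rw [abs_div, abs_of_pos hρ, div_le_iff₀ hρ]
  exact abs_apply_le hd hγ t y i j

omit [DecidableEq d] in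
/-- **`ρ ≤ (2/r_d)(γ₀ + |R|_F)`**. [folklore] -/
theorem rho_le (t : ℝ) (y : UnitAddTorus d) : rho γ₀ R t y ≤ 2 / radius d * (γ₀ + Real.sqrt (frobSq R t y)) := by
  have hr := radius_pos hd
  have h0 := frobSq_nonneg (R := R) t y
  unfold rho
  refine mul_le_mul_of_nonneg_left ?_ (by positivity)
  rw [Real.sqrt_le_left (by positivity)]
  nlinarith [Real.sq_sqrt h0, Real.sqrt_nonneg (frobSq R t y), hγ.le]

omit [DecidableEq d] in
/-- `ρ ≤ (2/r_d)(γ₀ + #d ‖R(t,y)‖)`. [folklore] -/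
theorem rho_le_norm (t : ℝ) (y : UnitAddTorus d) : rho γ₀ R t y ≤ 2 / radius d * (γ₀ + Fintype.card d * ‖R t y‖) := by
  have hr := radius_pos hd
  exact (rho_le hd hγ t y).trans (mul_le_mul_of_nonneg_left (by linarith [sqrt_frobSq_le_card_mul_norm (R := R) t y]) (by positivity))

/-- **`Id - R/ρ ∈ B̄(Id, r_d/2)`** (sup metric on `d → d → ℝ`). [folklore] -/
theorem dist_nmat_le (t : ℝ) (y : UnitAddTorus d) : dist (nmat γ₀ R t y) idMat ≤ radius d / 2 := by
  refine (dist_pi_le_iff (by linarith [radius_pos hd])).2 fun i => (dist_pi_le_iff (by linarith [radius_pos hd])).2 fun j => ?_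
  rw [Real.dist_eq, nmat]
  have h := abs_apply_div_rho_le (R := R) hd hγ t y i j
  rw [show (idMat : d → d → ℝ) i j - R t y j i / rho γ₀ R t y - idMat i j = -(R t y j i / rho γ₀ R t y) by ring, abs_neg]
  exact h

omit hd hγ in
/-- `Id - R/ρ` is symmetric when `R(t,y)` is. [folklore] -/
theorem nmat_symm {t : ℝ} {y : UnitAddTorus d} (hsym : ∀ i j, R t y i j = R t y j i) (i j : d) :
    nmat γ₀ R t y i j = nmat γ₀ R t y j i := by
  unfold nmat idMat
  by_cases hij : i = j
  · subst hij; rfl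
  · rw [if_neg hij, if_neg (Ne.symm hij), hsym j i]

/-- **The affine form, type `e_i`**: `hsq_{e_i} = ρ/2 - R_{ii}`. [folklore] -/
theorem hsq_inl (i : d) (t : ℝ) (y : UnitAddTorus d) : hsq γ₀ R (Sum.inl i) t y = rho γ₀ R t y / 2 - R t y i i := by
  have hρ := (rho_pos (R := R) hd hγ t y).ne'
  simp only [hsq, coeffSq_inl, nmat, idMat_apply_self]
  field_simp
  ring

/-- **The affine form, type `e_i + 2e_j`**: `hsq = ρ r_d/4 - R_{ji}/8` (`i ≠ j`). [folklore] -/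
theorem hsq_inr_inl (p : Pair d) (t : ℝ) (y : UnitAddTorus d) :
    hsq γ₀ R (Sum.inr (Sum.inl p)) t y = rho γ₀ R t y * (radius d / 4) - R t y p.1.2 p.1.1 / 8 := by
  have hρ := (rho_pos (R := R) hd hγ t y).ne'
  obtain ⟨⟨i, j⟩, hij⟩ := p
  simp only [hsq, coeffSq_inr_inl, nmat, idMat_apply_of_ne hij]
  field_simp
  ring

/-- **The affine form, type `e_i - 2e_j`**: `hsq = ρ r_d/4 + R_{ji}/8` (`i ≠ j`). [folklore] -/
theorem hsq_inr_inr (p : Pair d) (t : ℝ) (y : UnitAddTorus d) :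
    hsq γ₀ R (Sum.inr (Sum.inr p)) t y = rho γ₀ R t y * (radius d / 4) + R t y p.1.2 p.1.1 / 8 := by
  have hρ := (rho_pos (R := R) hd hγ t y).ne'
  obtain ⟨⟨i, j⟩, hij⟩ := p
  simp only [hsq, coeffSq_inr_inr, nmat, idMat_apply_of_ne hij]
  field_simp
  ring

/-- **The affine form, uniformly**: for every direction there are `|α| ≤ 1/2`, `|β| ≤ 1` and an entry
`(i, j)` with `hsq_x = α ρ + β R_{ij}` identically. [folklore] -/
theorem hsq_affine (x : Index d) : ∃ α β : ℝ, ∃ i j : d, |α| ≤ 1 / 2 ∧ |β| ≤ 1 ∧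
    ∀ t y, hsq γ₀ R x t y = α * rho γ₀ R t y + β * R t y j i := by
  have hr := radius_pos hd
  have hr' := radius_le hd
  rcases x with i | p | p
  · refine ⟨1 / 2, -1, i, i, by rw [abs_of_pos (by norm_num)], by norm_num, fun t y => ?_⟩
    rw [hsq_inl hd hγ]; ring
  · refine ⟨radius d / 4, -(1 / 8), p.1.1, p.1.2, ?_, by norm_num, fun t y => ?_⟩
    · rw [abs_of_pos (by positivity)]; linarith
    · rw [hsq_inr_inl hd hγ]; ring
  · refine ⟨radius d / 4, 1 / 8, p.1.1, p.1.2, ?_, by norm_num, fun t y => ?_⟩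
    · rw [abs_of_pos (by positivity)]; linarith
    · rw [hsq_inr_inr hd hγ]; ring

/-- **Floor and ceiling of the squared amplitudes**: `3γ₀/8 ≤ hsq_x ≤ ρ`. [folklore] -/
theorem hsq_bounds (x : Index d) (t : ℝ) (y : UnitAddTorus d) :
    3 * γ₀ / 8 ≤ hsq γ₀ R x t y ∧ hsq γ₀ R x t y ≤ rho γ₀ R t y := by
  have hr := radius_pos hd
  have hr' := radius_le hd
  have hρ := rho_pos (R := R) hd hγ t y
  have hρ' := le_rho (R := R) hd hγ t y
  have hρ'' : 2 * γ₀ ≤ radius d * rho γ₀ R t y := by rw [div_le_iff₀ hr] at hρ'; linarith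
  have hent : ∀ i j, |R t y j i| ≤ radius d / 2 * rho γ₀ R t y := abs_apply_le hd hγ t y
  rcases x with i | p | p
  · rw [hsq_inl hd hγ]
    have h := abs_le.1 (hent i i)
    constructor <;> nlinarith [h.1, h.2]
  · rw [hsq_inr_inl hd hγ]
    have h := abs_le.1 (hent p.1.1 p.1.2)
    constructor <;> nlinarith [h.1, h.2]
  · rw [hsq_inr_inr hd hγ]
    have h := abs_le.1 (hent p.1.1 p.1.2)
    constructor <;> nlinarith [h.1, h.2]

/-- `hsq_x > 0`. [folklore] -/
theorem hsq_pos (x : Index d) (t : ℝ) (y : UnitAddTorus d) : 0 < hsq γ₀ R x t y :=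
  lt_of_lt_of_le (by positivity) (hsq_bounds hd hγ x t y).1

/-- `a_x² = hsq_x`, `0 ≤ a_x`, `a_x ≤ √ρ`. [folklore] -/
theorem jamp_sq (x : Index d) (t : ℝ) (y : UnitAddTorus d) :
    jamp γ₀ R x t y ^ 2 = hsq γ₀ R x t y ∧ 0 ≤ jamp γ₀ R x t y ∧ jamp γ₀ R x t y ≤ Real.sqrt (rho γ₀ R t y) :=
  ⟨Real.sq_sqrt (hsq_pos hd hγ x t y).le, Real.sqrt_nonneg _, Real.sqrt_le_sqrt (hsq_bounds hd hγ x t y).2⟩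

/-- **The pointwise key identity**: `∑_x hsq_x (k_x)_a (k_x)_b = ρ δ_ab - R_ba` for symmetric `R(t,y)`
(geometric lemma on `B̄(Id, r_d)` applied to `Id - R/ρ`, times `ρ`). [cite: BuckmasterVicol2020, §7.5.1 (7.30)] -/
theorem sum_hsq_mul_dir {t : ℝ} {y : UnitAddTorus d} (hsym : ∀ i j, R t y i j = R t y j i) (a b : d) :
    ∑ x, hsq γ₀ R x t y * (((dir x a : ℤ) : ℝ) * ((dir x b : ℤ) : ℝ)) =
      rho γ₀ R t y * (if a = b then 1 else 0) - R t y b a := by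
  have hρ := rho_pos (R := R) hd hγ t y
  have hM : dist (nmat γ₀ R t y) idMat ≤ 2 * radius d := (dist_nmat_le hd hγ t y).trans (by linarith [radius_pos hd])
  have hdec := decomposition hd (nmat_symm hsym) hM a b
  simp_rw [hsq, mul_assoc, ← mul_sum]
  have h2 : ∑ x, coeffSq (nmat γ₀ R t y) x * (((dir x a : ℤ) : ℝ) * ((dir x b : ℤ) : ℝ)) = nmat γ₀ R t y a b := by
    rw [hdec]
    exact sum_congr rfl fun x _ => by rw [coeff_sq hd hM x]
  rw [h2, nmat, idMat, mul_sub, mul_div_cancel₀ _ hρ.ne']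

omit [DecidableEq d] in
/-- **The `L¹` size of `ρ`**: `ρ ≤ (2/r_d)(γ₀ + #d‖R‖)` integrates to
`∫ρ(t) ≤ (2/r_d)(γ₀ + #d ∫‖R(t)‖)`. [cite: BuckmasterVicol2020, §7.5.1 (7.27c)] -/
theorem integral_rho_le {t : ℝ} (hR : Torus.IsSmooth (R t)) (hρc : Continuous (rho γ₀ R t)) :
    ∫ y, rho γ₀ R t y ≤ 2 / radius d * (γ₀ + Fintype.card d * ∫ y, ‖R t y‖) := by
  have hr := radius_pos hd
  calc ∫ y, rho γ₀ R t y ≤ ∫ y, 2 / radius d * (γ₀ + Fintype.card d * ‖R t y‖) :=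
        MeasureTheory.integral_mono hρc.integrable_unitAddTorus
          ((continuous_const.add (continuous_const.mul hR.continuous.norm)).const_mul _ |>.integrable_unitAddTorus)
          fun y => rho_le_norm hd hγ t y
    _ = 2 / radius d * (γ₀ + Fintype.card d * ∫ y, ‖R t y‖) := by
        rw [MeasureTheory.integral_const_mul, MeasureTheory.integral_add (MeasureTheory.integrable_const _)
          (hR.continuous.norm.integrable_unitAddTorus.const_mul _), MeasureTheory.integral_const_mul,
          MeasureTheory.integral_const, smul_eq_mul, MeasureTheory.probReal_univ, one_mul]

end Pointwise

/-! ## Joint smoothness -/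

section Smooth

variable {S : Set ℝ} (hd : 2 ≤ Fintype.card d) (hγ : 0 < γ₀)
include hd hγ

omit [DecidableEq d] hd in
/-- **`ρ` is jointly smooth** where `R` is (`√` of a positive smooth function). [folklore] -/
theorem isSmoothSpaceTimeOn_rho (hR : Torus.IsSmoothSpaceTimeOn S R) : Torus.IsSmoothSpaceTimeOn S (rho γ₀ R) := by
  have h1 : Torus.IsSmoothSpaceTimeOn S (fun t y => γ₀ ^ 2 + frobSq R t y) :=
    (Torus.isSmoothSpaceTimeOn_const (Torus.isSmooth_const _) S).add (isSmoothSpaceTimeOn_frobSq hR)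
  exact (h1.sqrt fun t _ y => by have := frobSq_nonneg (R := R) t y; positivity).const_smul (2 / radius d)

omit [DecidableEq d] in
/-- `√ρ` is jointly smooth. [folklore] -/
theorem isSmoothSpaceTimeOn_sqrt_rho (hR : Torus.IsSmoothSpaceTimeOn S R) :
    Torus.IsSmoothSpaceTimeOn S (fun t y => Real.sqrt (rho γ₀ R t y)) :=
  (isSmoothSpaceTimeOn_rho hγ hR).sqrt fun t _ y => rho_pos hd hγ t y

/-- **`hsq_x` is jointly smooth** (affine in `ρ` and an entry of `R`). [folklore] -/
theorem isSmoothSpaceTimeOn_hsq (hR : Torus.IsSmoothSpaceTimeOn S R) (x : Index d) :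
    Torus.IsSmoothSpaceTimeOn S (hsq γ₀ R x) := by
  obtain ⟨α, β, i, j, -, -, h⟩ := hsq_affine (R := R) hd hγ x
  have e : hsq γ₀ R x = fun t y => α * rho γ₀ R t y + β * R t y j i := by funext t y; exact h t y
  rw [e]
  exact ((Torus.isSmoothSpaceTimeOn_const (Torus.isSmooth_const α) S).mul (isSmoothSpaceTimeOn_rho hγ hR)).add
    ((Torus.isSmoothSpaceTimeOn_const (Torus.isSmooth_const β) S).mul (isSmoothSpaceTimeOn_apply_apply hR i j))

/-- **`a_x` is jointly smooth** (`√` of `hsq_x ≥ 3γ₀/8 > 0`). [cite: BuckmasterVicol2020, §7.5.1] -/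
theorem isSmoothSpaceTimeOn_jamp (hR : Torus.IsSmoothSpaceTimeOn S R) (x : Index d) :
    Torus.IsSmoothSpaceTimeOn S (jamp γ₀ R x) :=
  (isSmoothSpaceTimeOn_hsq hd hγ hR x).sqrt fun t _ y => hsq_pos hd hγ x t y

end Smooth

/-! ## The one-dimensional second-derivative lemma -/

section OneD

omit [DecidableEq d]

set_option maxHeartbeats 800000 in
/-- **The one-dimensional lemma.** Along a path parametrised by `s ∈ I`, let the entries `e j i`
and the `ℓ`-derivative entries `f j i` have derivatives `e'`, `f'` at `s₀` within `I`, with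
`|e(s₀)| ≤ D₀`, `|f(s₀)| ≤ D₁`, `|e'| ≤ E₁`, `|f'| ≤ E₂`. Then the path expressions of `∂ₗhsq` and
`∂ₗjamp` (below) have derivatives at `s₀` within `I`, bounded explicitly. [folklore] -/
theorem oneD {I : Set ℝ} {s₀ γ₀ r α β D₀ D₁ E₁ E₂ : ℝ} (hγ : 0 < γ₀) (hr : 0 < r) (hα : |α| ≤ 1 / 2) (hβ : |β| ≤ 1)
    (hD₀ : 0 ≤ D₀) (hD₁ : 0 ≤ D₁) (hE₁ : 0 ≤ E₁) (hE₂ : 0 ≤ E₂)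
    {e f : d → d → ℝ → ℝ} {e' f' : d → d → ℝ} (j₀ i₀ : d)
    (he : ∀ j i, HasDerivWithinAt (e j i) (e' j i) I s₀) (hf : ∀ j i, HasDerivWithinAt (f j i) (f' j i) I s₀)
    (be : ∀ j i, |e j i s₀| ≤ D₀) (bf : ∀ j i, |f j i s₀| ≤ D₁) (be' : ∀ j i, |e' j i| ≤ E₁) (bf' : ∀ j i, |f' j i| ≤ E₂)
    (hHS : γ₀ / 4 ≤ α * ((2 / r) * Real.sqrt (γ₀ ^ 2 + ∑ i, ∑ j, e j i s₀ ^ 2)) + β * e j₀ i₀ s₀) :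
    let cd : ℝ := (Fintype.card d : ℝ) ^ 2
    let Hl : ℝ → ℝ := fun s => α * ((1 / r) * (∑ i, ∑ j, (f j i s * e j i s + e j i s * f j i s)) / Real.sqrt (γ₀ ^ 2 + ∑ i, ∑ j, e j i s ^ 2)) +
      β * f j₀ i₀ s
    let HS : ℝ → ℝ := fun s => α * ((2 / r) * Real.sqrt (γ₀ ^ 2 + ∑ i, ∑ j, e j i s ^ 2)) + β * e j₀ i₀ s
    let Bh : ℝ := (1 / r) * (cd * (2 * (E₁ * D₁ + D₀ * E₂)) / γ₀ + (cd * (2 * D₀ * D₁)) * (cd * (D₀ * E₁) / γ₀) / γ₀ ^ 2) + E₂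
    let Bh₀ : ℝ := (1 / r) * (cd * (2 * D₀ * D₁)) / γ₀ + D₁
    let BS : ℝ := (1 / r) * (cd * (D₀ * E₁) / γ₀) + E₁
    (∃ Hl' : ℝ, HasDerivWithinAt Hl Hl' I s₀ ∧ |Hl'| ≤ Bh) ∧ |Hl s₀| ≤ Bh₀ ∧
    (∃ A' : ℝ, HasDerivWithinAt (fun s => Hl s / (2 * Real.sqrt (HS s))) A' I s₀ ∧
      |A'| ≤ Bh / Real.sqrt γ₀ + 2 * Bh₀ * BS / (γ₀ * Real.sqrt γ₀)) := by
  intro cd Hl HS Bh Bh₀ BS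
  have hcd : (Fintype.card d : ℝ) ^ 2 = ∑ _j : d, ∑ _i : d, (1 : ℝ) := by
    simp [sum_const, card_univ, sq]
  -- the quadratic sums
  set Q : ℝ → ℝ := fun s => ∑ i, ∑ j, e j i s ^ 2 with hQ
  set Q' : ℝ := ∑ i, ∑ j, (e' j i * e j i s₀ + e j i s₀ * e' j i) with hQ'
  set L : ℝ → ℝ := fun s => ∑ i, ∑ j, (f j i s * e j i s + e j i s * f j i s) with hL
  set L' : ℝ := ∑ i, ∑ j, ((f' j i * e j i s₀ + f j i s₀ * e' j i) + (e' j i * f j i s₀ + e j i s₀ * f' j i)) with hL'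
  have hQd : HasDerivWithinAt Q Q' I s₀ := by
    have h : ∀ j i, HasDerivWithinAt (fun s => e j i s ^ 2) (e' j i * e j i s₀ + e j i s₀ * e' j i) I s₀ := fun j i => by
      have h2 := (he j i).mul (he j i)
      have e2 : (fun s => e j i s ^ 2) = fun s => e j i s * e j i s := funext fun s => sq _
      rw [e2]
      exact h2
    exact HasDerivWithinAt.fun_sum fun i _ => HasDerivWithinAt.fun_sum fun j _ => h j i
  have hLd : HasDerivWithinAt L L' I s₀ := by
    have h : ∀ j i, HasDerivWithinAt (fun s => f j i s * e j i s + e j i s * f j i s)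
        ((f' j i * e j i s₀ + f j i s₀ * e' j i) + (e' j i * f j i s₀ + e j i s₀ * f' j i)) I s₀ :=
      fun j i => ((hf j i).mul (he j i)).add ((he j i).mul (hf j i))
    exact HasDerivWithinAt.fun_sum fun i _ => HasDerivWithinAt.fun_sum fun j _ => h j i
  -- sizes of the sums
  have hsum_le : ∀ {g : d → d → ℝ} {C : ℝ}, (∀ j i, |g j i| ≤ C) → |∑ i, ∑ j, g j i| ≤ cd * C := by
    intro g C hg
    calc |∑ i, ∑ j, g j i| ≤ ∑ i, |∑ j, g j i| := abs_sum_le_sum_abs _ _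
      _ ≤ ∑ i, ∑ j, |g j i| := sum_le_sum fun i _ => abs_sum_le_sum_abs _ _
      _ ≤ ∑ _i : d, ∑ _j : d, C := sum_le_sum fun i _ => sum_le_sum fun j _ => hg j i
      _ = cd * C := by simp only [sum_const, card_univ, nsmul_eq_mul, cd]; ring
  have hQ0 : ∀ s, 0 ≤ Q s := fun s => sum_nonneg fun _ _ => sum_nonneg fun _ _ => sq_nonneg _
  have hQ'b : |Q'| ≤ cd * (2 * D₀ * E₁) := hsum_le fun j i => by
    calc |e' j i * e j i s₀ + e j i s₀ * e' j i| ≤ |e' j i * e j i s₀| + |e j i s₀ * e' j i| := abs_add_le _ _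
      _ ≤ E₁ * D₀ + D₀ * E₁ := by
          rw [abs_mul, abs_mul]
          exact add_le_add (mul_le_mul (be' j i) (be j i) (abs_nonneg _) hE₁) (mul_le_mul (be j i) (be' j i) (abs_nonneg _) hD₀)
      _ = 2 * D₀ * E₁ := by ring
  have hLb : |L s₀| ≤ cd * (2 * D₀ * D₁) := hsum_le fun j i => by
    calc |f j i s₀ * e j i s₀ + e j i s₀ * f j i s₀| ≤ |f j i s₀ * e j i s₀| + |e j i s₀ * f j i s₀| := abs_add_le _ _
      _ ≤ D₁ * D₀ + D₀ * D₁ := by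
          rw [abs_mul, abs_mul]
          exact add_le_add (mul_le_mul (bf j i) (be j i) (abs_nonneg _) hD₁) (mul_le_mul (be j i) (bf j i) (abs_nonneg _) hD₀)
      _ = 2 * D₀ * D₁ := by ring
  have hL'b : |L'| ≤ cd * (2 * (E₁ * D₁ + D₀ * E₂)) := hsum_le fun j i => by
    calc |(f' j i * e j i s₀ + f j i s₀ * e' j i) + (e' j i * f j i s₀ + e j i s₀ * f' j i)|
        ≤ |f' j i * e j i s₀ + f j i s₀ * e' j i| + |e' j i * f j i s₀ + e j i s₀ * f' j i| := abs_add_le _ _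
      _ ≤ (|f' j i * e j i s₀| + |f j i s₀ * e' j i|) + (|e' j i * f j i s₀| + |e j i s₀ * f' j i|) :=
          add_le_add (abs_add_le _ _) (abs_add_le _ _)
      _ ≤ (E₂ * D₀ + D₁ * E₁) + (E₁ * D₁ + D₀ * E₂) := by
          rw [abs_mul, abs_mul, abs_mul, abs_mul]
          exact add_le_add (add_le_add (mul_le_mul (bf' j i) (be j i) (abs_nonneg _) hE₂)
            (mul_le_mul (bf j i) (be' j i) (abs_nonneg _) hD₁))
            (add_le_add (mul_le_mul (be' j i) (bf j i) (abs_nonneg _) hE₁) (mul_le_mul (be j i) (bf' j i) (abs_nonneg _) hD₀))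
      _ = 2 * (E₁ * D₁ + D₀ * E₂) := by ring
  -- the square root `W = √(γ₀² + Q)`
  set W : ℝ → ℝ := fun s => Real.sqrt (γ₀ ^ 2 + Q s) with hW
  have hWpos : ∀ s, 0 < W s := fun s => Real.sqrt_pos.2 (by have := hQ0 s; positivity)
  have hWge : ∀ s, γ₀ ≤ W s := fun s => by
    calc γ₀ = Real.sqrt (γ₀ ^ 2) := (Real.sqrt_sq hγ.le).symm
      _ ≤ W s := Real.sqrt_le_sqrt (by linarith [hQ0 s])
  set W' : ℝ := Q' / (2 * W s₀) with hW'
  have hWd : HasDerivWithinAt W W' I s₀ := by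
    have h := (hQd.const_add (γ₀ ^ 2)).sqrt (by have := hQ0 s₀; positivity)
    simpa [hW, hW'] using h
  have hW'b : |W'| ≤ cd * (D₀ * E₁) / γ₀ := by
    rw [hW', abs_div, abs_of_pos (mul_pos two_pos (hWpos s₀))]
    rw [div_le_div_iff₀ (mul_pos two_pos (hWpos s₀)) hγ]
    have h1 := hWge s₀
    have h2 : 0 ≤ cd * (D₀ * E₁) := by positivity
    nlinarith [hQ'b, abs_nonneg Q', mul_le_mul_of_nonneg_left h1 h2]
  -- `P = (1/r) L / W`
  set P : ℝ → ℝ := fun s => (1 / r) * L s / W s with hP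
  set P' : ℝ := (1 / r) * ((L' * W s₀ - L s₀ * W') / W s₀ ^ 2) with hP'
  have hPd : HasDerivWithinAt P P' I s₀ := by
    have h := ((hLd.div hWd (hWpos s₀).ne')).const_mul (1 / r)
    have e1 : P = fun s => (1 / r) * (L s / W s) := by funext s; simp [hP]; ring
    rw [e1]; exact h
  have hPb : |P s₀| ≤ (1 / r) * (cd * (2 * D₀ * D₁)) / γ₀ := by
    simp only [hP]
    rw [abs_div, abs_mul, abs_of_pos (by positivity : (0:ℝ) < 1 / r), abs_of_pos (hWpos s₀), mul_div_assoc, mul_div_assoc]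
    refine mul_le_mul_of_nonneg_left ?_ (by positivity)
    rw [div_le_div_iff₀ (hWpos s₀) hγ]
    have := hWge s₀
    nlinarith [hLb, abs_nonneg (L s₀)]
  have hP'b : |P'| ≤ (1 / r) * (cd * (2 * (E₁ * D₁ + D₀ * E₂)) / γ₀ + (cd * (2 * D₀ * D₁)) * (cd * (D₀ * E₁) / γ₀) / γ₀ ^ 2) := by
    rw [hP', abs_mul, abs_of_pos (by positivity : (0:ℝ) < 1 / r)]
    refine mul_le_mul_of_nonneg_left ?_ (by positivity)
    have hW0 := hWpos s₀
    have hW2 : γ₀ ^ 2 ≤ W s₀ ^ 2 := pow_le_pow_left₀ hγ.le (hWge s₀) 2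
    have t1 : |L'| / W s₀ ≤ cd * (2 * (E₁ * D₁ + D₀ * E₂)) / γ₀ := by
      rw [div_le_div_iff₀ hW0 hγ]
      have h2 : 0 ≤ cd * (2 * (E₁ * D₁ + D₀ * E₂)) := by positivity
      nlinarith [hL'b, hWge s₀, abs_nonneg L', mul_le_mul_of_nonneg_left (hWge s₀) h2]
    have t2 : |L s₀| * |W'| / W s₀ ^ 2 ≤ (cd * (2 * D₀ * D₁)) * (cd * (D₀ * E₁) / γ₀) / γ₀ ^ 2 := by
      calc |L s₀| * |W'| / W s₀ ^ 2 ≤ |L s₀| * |W'| / γ₀ ^ 2 := div_le_div_of_nonneg_left (by positivity) (by positivity) hW2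
        _ ≤ _ := by gcongr
    calc |(L' * W s₀ - L s₀ * W') / W s₀ ^ 2| = |L' * W s₀ - L s₀ * W'| / W s₀ ^ 2 := by
          rw [abs_div, abs_of_pos (pow_pos hW0 2)]
      _ ≤ (|L'| * W s₀ + |L s₀| * |W'|) / W s₀ ^ 2 := by
          refine div_le_div_of_nonneg_right ((abs_sub _ _).trans (add_le_add ?_ ?_)) (pow_pos hW0 2).le
          · rw [abs_mul, abs_of_pos hW0]
          · rw [abs_mul]
      _ = |L'| / W s₀ + |L s₀| * |W'| / W s₀ ^ 2 := by field_simp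
      _ ≤ _ := add_le_add t1 t2
  -- `Hl = α P + β f₀`, its value and derivative
  have hHl : Hl = fun s => α * P s + β * f j₀ i₀ s := by funext s; simp only [Hl, hP]; ring
  set Hl' : ℝ := α * P' + β * f' j₀ i₀ with hHl'
  have hHld : HasDerivWithinAt Hl Hl' I s₀ := by
    rw [hHl]; exact (hPd.const_mul α).add ((hf j₀ i₀).const_mul β)
  have hα' : |α| ≤ 1 := hα.trans (by norm_num)
  have hHl'b : |Hl'| ≤ Bh := by
    have h1 : |α * P'| ≤ 1 * |P'| := by rw [abs_mul]; exact mul_le_mul_of_nonneg_right hα' (abs_nonneg _)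
    have h2 : |β * f' j₀ i₀| ≤ 1 * E₂ := by rw [abs_mul]; exact mul_le_mul hβ (bf' j₀ i₀) (abs_nonneg _) zero_le_one
    calc |Hl'| ≤ |α * P'| + |β * f' j₀ i₀| := abs_add_le _ _
      _ ≤ |P'| + E₂ := by linarith
      _ ≤ Bh := by simp only [Bh]; linarith [hP'b]
  have hHl0 : |Hl s₀| ≤ Bh₀ := by
    have e1 : Hl s₀ = α * P s₀ + β * f j₀ i₀ s₀ := by rw [hHl]
    rw [e1]
    have h1 : |α * P s₀| ≤ 1 * |P s₀| := by rw [abs_mul]; exact mul_le_mul_of_nonneg_right hα' (abs_nonneg _)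
    have h2 : |β * f j₀ i₀ s₀| ≤ 1 * D₁ := by rw [abs_mul]; exact mul_le_mul hβ (bf j₀ i₀) (abs_nonneg _) zero_le_one
    calc |α * P s₀ + β * f j₀ i₀ s₀| ≤ |α * P s₀| + |β * f j₀ i₀ s₀| := abs_add_le _ _
      _ ≤ |P s₀| + D₁ := by linarith
      _ ≤ Bh₀ := by simp only [Bh₀]; linarith [hPb]
  -- `HS = α (2/r) W + β e₀`, its derivative
  have hHSeq : HS = fun s => α * ((2 / r) * W s) + β * e j₀ i₀ s := by funext s; rfl
  set HS' : ℝ := α * ((2 / r) * W') + β * e' j₀ i₀ with hHS'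
  have hHSd : HasDerivWithinAt HS HS' I s₀ := by
    rw [hHSeq]; exact ((hWd.const_mul (2 / r)).const_mul α).add ((he j₀ i₀).const_mul β)
  have hHS'b : |HS'| ≤ BS := by
    have h1 : |α * ((2 / r) * W')| ≤ (1 / 2) * ((2 / r) * |W'|) := by
      rw [abs_mul, abs_mul, abs_of_pos (by positivity : (0:ℝ) < 2 / r)]
      exact mul_le_mul_of_nonneg_right hα (by positivity)
    have h2 : |β * e' j₀ i₀| ≤ 1 * E₁ := by rw [abs_mul]; exact mul_le_mul hβ (be' j₀ i₀) (abs_nonneg _) zero_le_one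
    calc |HS'| ≤ |α * ((2 / r) * W')| + |β * e' j₀ i₀| := abs_add_le _ _
      _ ≤ (1 / r) * |W'| + E₁ := by
          have e1 : (1 / 2) * ((2 / r) * |W'|) = (1 / r) * |W'| := by ring
          linarith
      _ ≤ BS := by
          simp only [BS]
          have := mul_le_mul_of_nonneg_left hW'b (by positivity : (0:ℝ) ≤ 1 / r)
          linarith
  have hHSpos : 0 < HS s₀ := lt_of_lt_of_le (by positivity) hHS
  -- the quotient `A = Hl / (2 √HS)`
  have hsq : HasDerivWithinAt (fun s => 2 * Real.sqrt (HS s)) (2 * (HS' / (2 * Real.sqrt (HS s₀)))) I s₀ :=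
    (hHSd.sqrt hHSpos.ne').const_mul 2
  have hden : (2 * Real.sqrt (HS s₀)) ≠ 0 := by have := Real.sqrt_pos.2 hHSpos; positivity
  have hAd := hHld.div hsq hden
  refine ⟨⟨Hl', hHld, hHl'b⟩, hHl0, ⟨_, hAd, ?_⟩⟩
  -- the bound on `A'`
  have hS0 : Real.sqrt γ₀ / 2 ≤ Real.sqrt (HS s₀) := by
    have h1 : Real.sqrt (γ₀ / 4) = Real.sqrt γ₀ / 2 := by
      rw [show γ₀ / 4 = γ₀ / 2 ^ 2 by norm_num, Real.sqrt_div' γ₀ (by norm_num : (0:ℝ) ≤ 2 ^ 2), Real.sqrt_sq (by norm_num)]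
    rw [← h1]; exact Real.sqrt_le_sqrt hHS
  have hsγ : 0 < Real.sqrt γ₀ := Real.sqrt_pos.2 hγ
  have hSpos : 0 < Real.sqrt (HS s₀) := Real.sqrt_pos.2 hHSpos
  set Sq := Real.sqrt (HS s₀) with hSq
  have hBh0 : 0 ≤ Bh := le_trans (abs_nonneg _) hHl'b
  have hBh00 : 0 ≤ Bh₀ := le_trans (abs_nonneg _) hHl0
  have hBS0 : 0 ≤ BS := le_trans (abs_nonneg _) hHS'b
  -- rewrite the derivative
  have e1 : (Hl' * (2 * Sq) - Hl s₀ * (2 * (HS' / (2 * Sq)))) / (2 * Sq) ^ 2 = Hl' / (2 * Sq) - Hl s₀ * HS' / (4 * Sq ^ 3) := by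
    field_simp
    ring
  rw [e1]
  have h2Sq : 0 < 2 * Sq := by positivity
  have h4Sq : 0 < 4 * Sq ^ 3 := by positivity
  have hlow : 0 < Real.sqrt γ₀ / 2 := by positivity
  have t1 : |Hl'| / (2 * Sq) ≤ Bh / (2 * (Real.sqrt γ₀ / 2)) :=
    (div_le_div_of_nonneg_right hHl'b h2Sq.le).trans
      (div_le_div_of_nonneg_left hBh0 (by positivity) (by linarith))
  have t2 : |Hl s₀| * |HS'| / (4 * Sq ^ 3) ≤ Bh₀ * BS / (4 * (Real.sqrt γ₀ / 2) ^ 3) := by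
    have hn : |Hl s₀| * |HS'| ≤ Bh₀ * BS := mul_le_mul hHl0 hHS'b (abs_nonneg _) hBh00
    have hp : (Real.sqrt γ₀ / 2) ^ 3 ≤ Sq ^ 3 := pow_le_pow_left₀ hlow.le hS0 3
    exact (div_le_div_of_nonneg_right hn h4Sq.le).trans
      (div_le_div_of_nonneg_left (by positivity) (by positivity) (by linarith))
  calc |Hl' / (2 * Sq) - Hl s₀ * HS' / (4 * Sq ^ 3)| ≤ |Hl' / (2 * Sq)| + |Hl s₀ * HS' / (4 * Sq ^ 3)| := abs_sub _ _
    _ = |Hl'| / (2 * Sq) + |Hl s₀| * |HS'| / (4 * Sq ^ 3) := by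
        rw [abs_div, abs_div, abs_of_pos h2Sq, abs_of_pos h4Sq, abs_mul (Hl s₀) HS']
    _ ≤ Bh / (2 * (Real.sqrt γ₀ / 2)) + Bh₀ * BS / (4 * (Real.sqrt γ₀ / 2) ^ 3) := add_le_add t1 t2
    _ = Bh / Real.sqrt γ₀ + 2 * Bh₀ * BS / (γ₀ * Real.sqrt γ₀) := by
        have h3 : Real.sqrt γ₀ ^ 2 = γ₀ := Real.sq_sqrt hγ.le
        field_simp
        rw [h3]
        ring


end OneD

/-! ## Derivatives along paths: first order -/

section Path

variable (hd : 2 ≤ Fintype.card d) (hγ : 0 < γ₀) {x : Index d}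
include hd hγ

/-- **First derivatives along a path.** If along a path `s ↦ (τ s, p s)` through `(τ s₀, p s₀) = (t, y)`
every entry `s ↦ R (τ s) (p s) j i` has derivative `e' j i` at `s₀` within `I`, then along the path
`ρ`, `hsq_x`, `jamp_x` have the derivatives
`ρ' = (1/r_d)(∑ 2 R_{ji} e'_{ji})/√(γ₀² + |R|_F²)`, `hsq' = α ρ' + β e'_{j₀i₀}`, `jamp' = hsq'/(2 jamp)`
(with `(α, β, i₀, j₀)` from `hsq_affine`). [folklore] -/
theorem hasDerivWithinAt_path {I : Set ℝ} {s₀ : ℝ} {τ : ℝ → ℝ} {p : ℝ → UnitAddTorus d} {e' : d → d → ℝ}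
    (he : ∀ j i, HasDerivWithinAt (fun s => R (τ s) (p s) j i) (e' j i) I s₀)
    {α β : ℝ} {i₀ j₀ : d} (haff : ∀ t y, hsq γ₀ R x t y = α * rho γ₀ R t y + β * R t y j₀ i₀) :
    let ρ' : ℝ := (1 / radius d) * (∑ i, ∑ j, (e' j i * R (τ s₀) (p s₀) j i + R (τ s₀) (p s₀) j i * e' j i)) /
      Real.sqrt (γ₀ ^ 2 + frobSq R (τ s₀) (p s₀))
    HasDerivWithinAt (fun s => rho γ₀ R (τ s) (p s)) ρ' I s₀ ∧
    HasDerivWithinAt (fun s => hsq γ₀ R x (τ s) (p s)) (α * ρ' + β * e' j₀ i₀) I s₀ ∧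
    HasDerivWithinAt (fun s => jamp γ₀ R x (τ s) (p s)) ((α * ρ' + β * e' j₀ i₀) / (2 * jamp γ₀ R x (τ s₀) (p s₀))) I s₀ := by
  intro ρ'
  have hq : HasDerivWithinAt (fun s => frobSq R (τ s) (p s))
      (∑ i, ∑ j, (e' j i * R (τ s₀) (p s₀) j i + R (τ s₀) (p s₀) j i * e' j i)) I s₀ := by
    have h : ∀ j i, HasDerivWithinAt (fun s => R (τ s) (p s) j i ^ 2) (e' j i * R (τ s₀) (p s₀) j i + R (τ s₀) (p s₀) j i * e' j i) I s₀ :=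
      fun j i => by
        have h2 := (he j i).mul (he j i)
        have e2 : (fun s => R (τ s) (p s) j i ^ 2) = fun s => R (τ s) (p s) j i * R (τ s) (p s) j i := funext fun s => sq _
        rw [e2]; exact h2
    have : (fun s => frobSq R (τ s) (p s)) = fun s => ∑ i, ∑ j, R (τ s) (p s) j i ^ 2 := rfl
    rw [this]
    exact HasDerivWithinAt.fun_sum fun i _ => HasDerivWithinAt.fun_sum fun j _ => h j i
  have hρ : HasDerivWithinAt (fun s => rho γ₀ R (τ s) (p s)) ρ' I s₀ := by
    have hpos : γ₀ ^ 2 + frobSq R (τ s₀) (p s₀) ≠ 0 := by have := frobSq_nonneg (R := R) (τ s₀) (p s₀); positivity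
    have h := ((hq.const_add (γ₀ ^ 2)).sqrt hpos).const_mul (2 / radius d)
    have e1 : (fun s => rho γ₀ R (τ s) (p s)) = fun s => 2 / radius d * Real.sqrt (γ₀ ^ 2 + frobSq R (τ s) (p s)) := rfl
    rw [e1]
    refine h.congr_deriv ?_
    have := (radius_pos hd).ne'
    have hW := (sqrt_pos (R := R) hγ (τ s₀) (p s₀)).ne'
    simp only [ρ']
    generalize (∑ i, ∑ j, (e' j i * R (τ s₀) (p s₀) j i + R (τ s₀) (p s₀) j i * e' j i)) = S
    field_simp
  have hh : HasDerivWithinAt (fun s => hsq γ₀ R x (τ s) (p s)) (α * ρ' + β * e' j₀ i₀) I s₀ := by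
    have e1 : (fun s => hsq γ₀ R x (τ s) (p s)) = fun s => α * rho γ₀ R (τ s) (p s) + β * R (τ s) (p s) j₀ i₀ :=
      funext fun s => haff _ _
    rw [e1]
    exact (hρ.const_mul α).add ((he j₀ i₀).const_mul β)
  refine ⟨hρ, hh, ?_⟩
  have hpos := (hsq_pos (R := R) hd hγ x (τ s₀) (p s₀)).ne'
  have h := hh.sqrt hpos
  exact h

omit [DecidableEq d] hd hγ in
/-- Sizes of double sums. [folklore] -/
theorem abs_sum_sum_le {g : d → d → ℝ} {C : ℝ} (hg : ∀ j i, |g j i| ≤ C) : |∑ i, ∑ j, g j i| ≤ (Fintype.card d : ℝ) ^ 2 * C := by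
  calc |∑ i, ∑ j, g j i| ≤ ∑ i, |∑ j, g j i| := abs_sum_le_sum_abs _ _
    _ ≤ ∑ i, ∑ j, |g j i| := sum_le_sum fun i _ => abs_sum_le_sum_abs _ _
    _ ≤ ∑ _i : d, ∑ _j : d, C := sum_le_sum fun i _ => sum_le_sum fun j _ => hg j i
    _ = (Fintype.card d : ℝ) ^ 2 * C := by simp only [sum_const, card_univ, nsmul_eq_mul]; ring

/-- **First-order bounds along a path**: with `|R_{ji}| ≤ D₀`, `|e'_{ji}| ≤ E₁` at the point,
`|ρ'| ≤ (1/r_d) 2d² D₀E₁/γ₀`, `|hsq'| ≤ |ρ'|/2 + E₁`, `|jamp'| ≤ |hsq'|/√γ₀`. [folklore] -/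
theorem path_bounds {t : ℝ} {y : UnitAddTorus d} {e' : d → d → ℝ} {D₀ E₁ : ℝ} (hE₁ : 0 ≤ E₁)
    (be : ∀ j i, |R t y j i| ≤ D₀) (be' : ∀ j i, |e' j i| ≤ E₁) {α β : ℝ} {i₀ j₀ : d} (hα : |α| ≤ 1 / 2) (hβ : |β| ≤ 1) :
    let ρ' : ℝ := (1 / radius d) * (∑ i, ∑ j, (e' j i * R t y j i + R t y j i * e' j i)) / Real.sqrt (γ₀ ^ 2 + frobSq R t y)
    |ρ'| ≤ (1 / radius d) * ((Fintype.card d : ℝ) ^ 2 * (2 * D₀ * E₁)) / γ₀ ∧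
    |α * ρ' + β * e' j₀ i₀| ≤ (1 / radius d) * ((Fintype.card d : ℝ) ^ 2 * (2 * D₀ * E₁)) / γ₀ / 2 + E₁ ∧
    |(α * ρ' + β * e' j₀ i₀) / (2 * jamp γ₀ R x t y)| ≤
      ((1 / radius d) * ((Fintype.card d : ℝ) ^ 2 * (2 * D₀ * E₁)) / γ₀ / 2 + E₁) / Real.sqrt γ₀ := by
  intro ρ'
  have hr := radius_pos hd
  have hD₀ : 0 ≤ D₀ := (abs_nonneg _).trans (be j₀ i₀)
  have hW : γ₀ ≤ Real.sqrt (γ₀ ^ 2 + frobSq R t y) := (le_sqrt (R := R) hγ t y).1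
  have hWpos : 0 < Real.sqrt (γ₀ ^ 2 + frobSq R t y) := lt_of_lt_of_le hγ hW
  have hnum : |∑ i, ∑ j, (e' j i * R t y j i + R t y j i * e' j i)| ≤ (Fintype.card d : ℝ) ^ 2 * (2 * D₀ * E₁) :=
    abs_sum_sum_le fun j i => by
      calc |e' j i * R t y j i + R t y j i * e' j i| ≤ |e' j i * R t y j i| + |R t y j i * e' j i| := abs_add_le _ _
        _ ≤ E₁ * D₀ + D₀ * E₁ := by
            rw [abs_mul, abs_mul]
            exact add_le_add (mul_le_mul (be' j i) (be j i) (abs_nonneg _) hE₁) (mul_le_mul (be j i) (be' j i) (abs_nonneg _) hD₀)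
        _ = 2 * D₀ * E₁ := by ring
  have h1 : |ρ'| ≤ (1 / radius d) * ((Fintype.card d : ℝ) ^ 2 * (2 * D₀ * E₁)) / γ₀ := by
    simp only [ρ']
    rw [abs_div, abs_mul, abs_of_pos (by positivity : (0:ℝ) < 1 / radius d), abs_of_pos hWpos, mul_div_assoc, mul_div_assoc]
    refine mul_le_mul_of_nonneg_left ?_ (by positivity)
    rw [div_le_div_iff₀ hWpos hγ]
    have h2 : 0 ≤ (Fintype.card d : ℝ) ^ 2 * (2 * D₀ * E₁) := by positivity
    nlinarith [hnum, abs_nonneg (∑ i, ∑ j, (e' j i * R t y j i + R t y j i * e' j i)), mul_le_mul_of_nonneg_left hW h2]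
  have h2 : |α * ρ' + β * e' j₀ i₀| ≤ (1 / radius d) * ((Fintype.card d : ℝ) ^ 2 * (2 * D₀ * E₁)) / γ₀ / 2 + E₁ := by
    have a1 : |α * ρ'| ≤ (1 / 2) * |ρ'| := by rw [abs_mul]; exact mul_le_mul_of_nonneg_right hα (abs_nonneg _)
    have a2 : |β * e' j₀ i₀| ≤ 1 * E₁ := by rw [abs_mul]; exact mul_le_mul hβ (be' j₀ i₀) (abs_nonneg _) zero_le_one
    calc |α * ρ' + β * e' j₀ i₀| ≤ |α * ρ'| + |β * e' j₀ i₀| := abs_add_le _ _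
      _ ≤ (1 / 2) * |ρ'| + E₁ := by linarith
      _ ≤ _ := by linarith [h1]
  refine ⟨h1, h2, ?_⟩
  have hj : Real.sqrt γ₀ / 2 ≤ jamp γ₀ R x t y := by
    have h3 : Real.sqrt (γ₀ / 4) = Real.sqrt γ₀ / 2 := by
      rw [show γ₀ / 4 = γ₀ / 2 ^ 2 by norm_num, Real.sqrt_div' γ₀ (by norm_num : (0:ℝ) ≤ 2 ^ 2), Real.sqrt_sq (by norm_num)]
    rw [← h3]
    exact Real.sqrt_le_sqrt (by linarith [(hsq_bounds (R := R) hd hγ x t y).1])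
  have hjpos : 0 < jamp γ₀ R x t y := lt_of_lt_of_le (by positivity) hj
  rw [abs_div, abs_of_pos (by positivity : (0:ℝ) < 2 * jamp γ₀ R x t y)]
  calc |α * ρ' + β * e' j₀ i₀| / (2 * jamp γ₀ R x t y) ≤ |α * ρ' + β * e' j₀ i₀| / (2 * (Real.sqrt γ₀ / 2)) :=
        div_le_div_of_nonneg_left (abs_nonneg _) (by positivity) (by linarith)
    _ = |α * ρ' + β * e' j₀ i₀| / Real.sqrt γ₀ := by ring
    _ ≤ _ := div_le_div_of_nonneg_right h2 (Real.sqrt_nonneg _)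

end Path

/-! ## Entries of tensor fields and their derivatives -/

section Entries

variable {S : Set ℝ} (hR : Torus.IsSmoothSpaceTimeOn S R) (hU : UniqueDiffOn ℝ S)
include hR

omit [DecidableEq d] in
/-- Entry slices are smooth. [folklore] -/
theorem isSmooth_entry {t : ℝ} (ht : t ∈ S) (j i : d) : Torus.IsSmooth (fun y => R t y j i) :=
  (isSmoothSpaceTimeOn_apply_apply hR i j).isSmooth_slice ht

omit [DecidableEq d] hR in
/-- `|R_{ji}| ≤ ‖R(t,y)‖`. [folklore] -/
theorem abs_entry_le (t : ℝ) (y : UnitAddTorus d) (j i : d) : |R t y j i| ≤ ‖R t y‖ :=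
  ((Real.norm_eq_abs _).symm.le.trans (PiLp.norm_apply_le (R t y j) i)).trans (norm_le_pi_norm (R t y) j)

omit [Fintype d] [DecidableEq d] hR in
/-- The evaluation functional `w ↦ w j i` on tensors. [folklore] -/
theorem entryCLM_apply (j i : d) (w : d → EuclideanSpace ℝ d) :
    ((EuclideanSpace.proj i).comp (ContinuousLinearMap.proj (R := ℝ) (φ := fun _ : d => EuclideanSpace ℝ d) j)) w = w j i := rfl

/-- **Space derivatives of entries are entries of space derivatives.** [folklore] -/
theorem partialDeriv_entry {t : ℝ} (ht : t ∈ S) (l : d) (y : UnitAddTorus d) (j i : d) :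
    Torus.partialDeriv l (fun z => R t z j i) y = Torus.partialDeriv l (R t) y j i := by
  have h := Torus.partialDeriv_clm_comp (hR.isSmooth_slice ht)
    ((EuclideanSpace.proj i).comp (ContinuousLinearMap.proj (R := ℝ) (φ := fun _ : d => EuclideanSpace ℝ d) j)) l y
  exact h

/-- `|∂ₗR_{ji}| ≤ ‖∂ₗR(t,y)‖`. [folklore] -/
theorem abs_partialDeriv_entry_le {t : ℝ} (ht : t ∈ S) (l : d) (y : UnitAddTorus d) (j i : d) :
    |Torus.partialDeriv l (fun z => R t z j i) y| ≤ ‖Torus.partialDeriv l (R t) y‖ := by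
  rw [partialDeriv_entry hR ht]
  exact ((Real.norm_eq_abs _).symm.le.trans (PiLp.norm_apply_le _ i)).trans (norm_le_pi_norm _ j)

/-- Second space derivatives of entries. [folklore] -/
theorem partialDeriv_partialDeriv_entry {t : ℝ} (ht : t ∈ S) (m l : d) (y : UnitAddTorus d) (j i : d) :
    Torus.partialDeriv m (Torus.partialDeriv l (fun z => R t z j i)) y =
      Torus.partialDeriv m (Torus.partialDeriv l (R t)) y j i := by
  have e : Torus.partialDeriv l (fun z => R t z j i) = fun z => Torus.partialDeriv l (R t) z j i :=
    funext fun z => partialDeriv_entry hR ht l z j i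
  rw [e]
  exact Torus.partialDeriv_clm_comp ((hR.isSmooth_slice ht).partialDeriv l)
    ((EuclideanSpace.proj i).comp (ContinuousLinearMap.proj (R := ℝ) (φ := fun _ : d => EuclideanSpace ℝ d) j)) m y

/-- `|∂ₘ∂ₗR_{ji}| ≤ ‖∂ₘ∂ₗR(t,y)‖`. [folklore] -/
theorem abs_partialDeriv_partialDeriv_entry_le {t : ℝ} (ht : t ∈ S) (m l : d) (y : UnitAddTorus d) (j i : d) :
    |Torus.partialDeriv m (Torus.partialDeriv l (fun z => R t z j i)) y| ≤
      ‖Torus.partialDeriv m (Torus.partialDeriv l (R t)) y‖ := by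
  rw [partialDeriv_partialDeriv_entry hR ht]
  exact ((Real.norm_eq_abs _).symm.le.trans (PiLp.norm_apply_le _ i)).trans (norm_le_pi_norm _ j)

include hU

omit [DecidableEq d] in
/-- **Time derivatives of entries are entries of time derivatives.** [folklore] -/
theorem timeDerivWithin_entry {t : ℝ} (ht : t ∈ S) (y : UnitAddTorus d) (j i : d) :
    Torus.timeDerivWithin S (fun s z => R s z j i) t y = Torus.timeDerivWithin S R t y j i := by
  have h := hR.hasDerivWithinAt_slice ht y
  have h2 := ((EuclideanSpace.proj i).comp (ContinuousLinearMap.proj (R := ℝ) (φ := fun _ : d => EuclideanSpace ℝ d) j)).hasFDerivAt.comp_hasDerivWithinAt t h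
  exact h2.derivWithin (hU t ht)

omit [DecidableEq d] in
/-- `|∂ₜR_{ji}| ≤ ‖∂ₜR(t,y)‖`. [folklore] -/
theorem abs_timeDerivWithin_entry_le {t : ℝ} (ht : t ∈ S) (y : UnitAddTorus d) (j i : d) :
    |Torus.timeDerivWithin S (fun s z => R s z j i) t y| ≤ ‖Torus.timeDerivWithin S R t y‖ := by
  rw [timeDerivWithin_entry hR hU ht]
  exact ((Real.norm_eq_abs _).symm.le.trans (PiLp.norm_apply_le _ i)).trans (norm_le_pi_norm _ j)

/-- Time derivatives of the space derivatives of entries. [folklore] -/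
theorem timeDerivWithin_partialDeriv_entry {t : ℝ} (ht : t ∈ S) (l : d) (y : UnitAddTorus d) (j i : d) :
    Torus.timeDerivWithin S (fun s z => Torus.partialDeriv l (fun w => R s w j i) z) t y =
      Torus.timeDerivWithin S (fun s z => Torus.partialDeriv l (R s) z) t y j i := by
  have h := (hR.partialDeriv hU l).hasDerivWithinAt_slice ht y
  have h2 := ((EuclideanSpace.proj i).comp (ContinuousLinearMap.proj (R := ℝ) (φ := fun _ : d => EuclideanSpace ℝ d) j)).hasFDerivAt.comp_hasDerivWithinAt t h
  have h3 : HasDerivWithinAt (fun s => Torus.partialDeriv l (fun w => R s w j i) y)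
      (Torus.timeDerivWithin S (fun s z => Torus.partialDeriv l (R s) z) t y j i) S t :=
    h2.congr_of_mem (fun s hs => partialDeriv_entry hR hs l y j i) ht
  exact h3.derivWithin (hU t ht)

/-- `|∂ₜ∂ₗR_{ji}| ≤ ‖∂ₜ∂ₗR(t,y)‖`. [folklore] -/
theorem abs_timeDerivWithin_partialDeriv_entry_le {t : ℝ} (ht : t ∈ S) (l : d) (y : UnitAddTorus d) (j i : d) :
    |Torus.timeDerivWithin S (fun s z => Torus.partialDeriv l (fun w => R s w j i) z) t y| ≤
      ‖Torus.timeDerivWithin S (fun s z => Torus.partialDeriv l (R s) z) t y‖ := by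
  rw [timeDerivWithin_partialDeriv_entry hR hU ht]
  exact ((Real.norm_eq_abs _).symm.le.trans (PiLp.norm_apply_le _ i)).trans (norm_le_pi_norm _ j)

end Entries

/-! ## First-order derivatives on the torus and in time -/

section FirstOrder

variable (hd : 2 ≤ Fintype.card d) (hγ : 0 < γ₀) {x : Index d} {S : Set ℝ} (hR : Torus.IsSmoothSpaceTimeOn S R)
  (hU : UniqueDiffOn ℝ S)
include hd hγ hR

omit [Fintype d] [DecidableEq d] hd hγ hR in
/-- `proj 0 = 0` and the line through `y` passes through `y` at `s = 0`. [folklore] -/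
theorem line_zero (y : UnitAddTorus d) (v : EuclideanSpace ℝ d) : y + Torus.proj ((0 : ℝ) • v) = y := by
  rw [zero_smul]
  have : Torus.proj (0 : EuclideanSpace ℝ d) = (0 : UnitAddTorus d) := by funext i; simp [Torus.proj]
  rw [this, add_zero]

/-- **Space derivatives: formulas.** [folklore] -/
theorem partialDeriv_formulas {t : ℝ} (ht : t ∈ S) (l : d) (y : UnitAddTorus d) {α β : ℝ} {i₀ j₀ : d}
    (haff : ∀ t y, hsq γ₀ R x t y = α * rho γ₀ R t y + β * R t y j₀ i₀) :
    let e' : d → d → ℝ := fun j i => Torus.partialDeriv l (fun z => R t z j i) y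
    let ρ' : ℝ := (1 / radius d) * (∑ i, ∑ j, (e' j i * R t y j i + R t y j i * e' j i)) / Real.sqrt (γ₀ ^ 2 + frobSq R t y)
    Torus.partialDeriv l (rho γ₀ R t) y = ρ' ∧ Torus.partialDeriv l (hsq γ₀ R x t) y = α * ρ' + β * e' j₀ i₀ ∧
    Torus.partialDeriv l (jamp γ₀ R x t) y = (α * ρ' + β * e' j₀ i₀) / (2 * jamp γ₀ R x t y) := by
  intro e' ρ'
  have he : ∀ j i, HasDerivWithinAt (fun s : ℝ => R t (y + Torus.proj (s • EuclideanSpace.single l (1 : ℝ))) j i) (e' j i) univ 0 :=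
    fun j i => ((isSmooth_entry hR ht j i).hasDerivAt_line_zero l y).hasDerivWithinAt
  obtain ⟨h1, h2, h3⟩ := hasDerivWithinAt_path (x := x) hd hγ (τ := fun _ => t)
    (p := fun s : ℝ => y + Torus.proj (s • EuclideanSpace.single l (1 : ℝ))) he haff
  simp only [line_zero] at h1 h2 h3
  exact ⟨(hasDerivWithinAt_univ.1 h1).deriv, (hasDerivWithinAt_univ.1 h2).deriv, (hasDerivWithinAt_univ.1 h3).deriv⟩

/-- **Space derivatives: bounds** (`D₀ ≥ ‖R(t,y)‖`, `D₁ ≥ ‖∂ₗR(t,y)‖`). [folklore] -/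
theorem partialDeriv_bounds {t : ℝ} (ht : t ∈ S) (l : d) (y : UnitAddTorus d) {D₀ D₁ : ℝ} (hD₁ : 0 ≤ D₁)
    (b0 : ‖R t y‖ ≤ D₀) (b1 : ‖Torus.partialDeriv l (R t) y‖ ≤ D₁) :
    |Torus.partialDeriv l (rho γ₀ R t) y| ≤ (1 / radius d) * ((Fintype.card d : ℝ) ^ 2 * (2 * D₀ * D₁)) / γ₀ ∧
    |Torus.partialDeriv l (hsq γ₀ R x t) y| ≤ (1 / radius d) * ((Fintype.card d : ℝ) ^ 2 * (2 * D₀ * D₁)) / γ₀ / 2 + D₁ ∧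
    |Torus.partialDeriv l (jamp γ₀ R x t) y| ≤
      ((1 / radius d) * ((Fintype.card d : ℝ) ^ 2 * (2 * D₀ * D₁)) / γ₀ / 2 + D₁) / Real.sqrt γ₀ := by
  obtain ⟨α, β, i₀, j₀, hα, hβ, haff⟩ := hsq_affine (R := R) hd hγ x
  obtain ⟨f1, f2, f3⟩ := partialDeriv_formulas (x := x) hd hγ hR ht l y haff
  obtain ⟨b1', b2', b3'⟩ := path_bounds (x := x) hd hγ (t := t) (y := y)
    (e' := fun j i => Torus.partialDeriv l (fun z => R t z j i) y) hD₁
    (fun j i => (abs_entry_le t y j i).trans b0) (fun j i => (abs_partialDeriv_entry_le hR ht l y j i).trans b1) hα hβ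
    (i₀ := i₀) (j₀ := j₀)
  rw [f1, f2, f3]
  exact ⟨b1', b2', b3'⟩

include hU

/-- **Time derivatives: formulas.** [folklore] -/
theorem timeDerivWithin_formulas {t : ℝ} (ht : t ∈ S) (y : UnitAddTorus d) {α β : ℝ} {i₀ j₀ : d}
    (haff : ∀ t y, hsq γ₀ R x t y = α * rho γ₀ R t y + β * R t y j₀ i₀) :
    let e' : d → d → ℝ := fun j i => Torus.timeDerivWithin S (fun s z => R s z j i) t y
    let ρ' : ℝ := (1 / radius d) * (∑ i, ∑ j, (e' j i * R t y j i + R t y j i * e' j i)) / Real.sqrt (γ₀ ^ 2 + frobSq R t y)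
    Torus.timeDerivWithin S (rho γ₀ R) t y = ρ' ∧ Torus.timeDerivWithin S (hsq γ₀ R x) t y = α * ρ' + β * e' j₀ i₀ ∧
    Torus.timeDerivWithin S (jamp γ₀ R x) t y = (α * ρ' + β * e' j₀ i₀) / (2 * jamp γ₀ R x t y) := by
  intro e' ρ'
  have he : ∀ j i, HasDerivWithinAt (fun s => R s y j i) (e' j i) S t := fun j i =>
    (isSmoothSpaceTimeOn_apply_apply hR i j).hasDerivWithinAt_slice ht y
  obtain ⟨h1, h2, h3⟩ := hasDerivWithinAt_path (x := x) hd hγ (τ := fun s => s) (p := fun _ => y) he haff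
  exact ⟨h1.derivWithin (hU t ht), h2.derivWithin (hU t ht), h3.derivWithin (hU t ht)⟩

/-- **Time derivatives: bounds** (`D₀ ≥ ‖R(t,y)‖`, `D₁ ≥ ‖∂ₜR(t,y)‖`). [folklore] -/
theorem timeDerivWithin_bounds {t : ℝ} (ht : t ∈ S) (y : UnitAddTorus d) {D₀ D₁ : ℝ} (hD₁ : 0 ≤ D₁)
    (b0 : ‖R t y‖ ≤ D₀) (b1 : ‖Torus.timeDerivWithin S R t y‖ ≤ D₁) :
    |Torus.timeDerivWithin S (rho γ₀ R) t y| ≤ (1 / radius d) * ((Fintype.card d : ℝ) ^ 2 * (2 * D₀ * D₁)) / γ₀ ∧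
    |Torus.timeDerivWithin S (hsq γ₀ R x) t y| ≤ (1 / radius d) * ((Fintype.card d : ℝ) ^ 2 * (2 * D₀ * D₁)) / γ₀ / 2 + D₁ ∧
    |Torus.timeDerivWithin S (jamp γ₀ R x) t y| ≤
      ((1 / radius d) * ((Fintype.card d : ℝ) ^ 2 * (2 * D₀ * D₁)) / γ₀ / 2 + D₁) / Real.sqrt γ₀ := by
  obtain ⟨α, β, i₀, j₀, hα, hβ, haff⟩ := hsq_affine (R := R) hd hγ x
  obtain ⟨f1, f2, f3⟩ := timeDerivWithin_formulas (x := x) hd hγ hR hU ht y haff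
  obtain ⟨b1', b2', b3'⟩ := path_bounds (x := x) hd hγ (t := t) (y := y)
    (e' := fun j i => Torus.timeDerivWithin S (fun s z => R s z j i) t y) hD₁
    (fun j i => (abs_entry_le t y j i).trans b0) (fun j i => (abs_timeDerivWithin_entry_le hR hU ht y j i).trans b1) hα hβ
    (i₀ := i₀) (j₀ := j₀)
  rw [f1, f2, f3]
  exact ⟨b1', b2', b3'⟩

end FirstOrder

/-! ## Second-order derivatives -/

section SecondOrder

variable (hd : 2 ≤ Fintype.card d) (hγ : 0 < γ₀) {x : Index d} {S : Set ℝ} (hR : Torus.IsSmoothSpaceTimeOn S R)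
  (hU : UniqueDiffOn ℝ S)
include hd hγ hR

/-- The second-order bound expressions of the one-dimensional lemma with `E₁ = D₁`, `E₂ = D₂`. [folklore] -/
def bh (d : Type*) [Fintype d] (γ₀ D₀ D₁ D₂ : ℝ) : ℝ :=
  (1 / radius d) * (((Fintype.card d : ℝ) ^ 2) * (2 * (D₁ * D₁ + D₀ * D₂)) / γ₀ +
    (((Fintype.card d : ℝ) ^ 2) * (2 * D₀ * D₁)) * (((Fintype.card d : ℝ) ^ 2) * (D₀ * D₁) / γ₀) / γ₀ ^ 2) + D₂

/-- `Bh₀`. [folklore] -/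
def bh₀ (d : Type*) [Fintype d] (γ₀ D₀ D₁ : ℝ) : ℝ := (1 / radius d) * (((Fintype.card d : ℝ) ^ 2) * (2 * D₀ * D₁)) / γ₀ + D₁

/-- `BS`. [folklore] -/
def bs (d : Type*) [Fintype d] (γ₀ D₀ D₁ : ℝ) : ℝ := (1 / radius d) * (((Fintype.card d : ℝ) ^ 2) * (D₀ * D₁) / γ₀) + D₁

/-- **Second space derivatives: bounds.** [folklore] -/
theorem partialDeriv_partialDeriv_bounds {t : ℝ} (ht : t ∈ S) (m l : d) (y : UnitAddTorus d) {D₀ D₁ D₂ : ℝ}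
    (h0 : 0 ≤ D₀) (h1 : 0 ≤ D₁) (h2 : 0 ≤ D₂) (b0 : ‖R t y‖ ≤ D₀) (b1l : ‖Torus.partialDeriv l (R t) y‖ ≤ D₁)
    (b1m : ‖Torus.partialDeriv m (R t) y‖ ≤ D₁) (b2 : ‖Torus.partialDeriv m (Torus.partialDeriv l (R t)) y‖ ≤ D₂) :
    |Torus.partialDeriv m (Torus.partialDeriv l (hsq γ₀ R x t)) y| ≤ bh d γ₀ D₀ D₁ D₂ ∧
    |Torus.partialDeriv m (Torus.partialDeriv l (jamp γ₀ R x t)) y| ≤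
      bh d γ₀ D₀ D₁ D₂ / Real.sqrt γ₀ + 2 * bh₀ d γ₀ D₀ D₁ * bs d γ₀ D₀ D₁ / (γ₀ * Real.sqrt γ₀) := by
  obtain ⟨α, β, i₀, j₀, hα, hβ, haff⟩ := hsq_affine (R := R) hd hγ x
  set v : EuclideanSpace ℝ d := EuclideanSpace.single m (1 : ℝ) with hv
  -- the path data
  have he : ∀ j i, HasDerivWithinAt (fun s : ℝ => R t (y + Torus.proj (s • v)) j i)
      (Torus.partialDeriv m (fun z => R t z j i) y) univ 0 := fun j i =>
    ((isSmooth_entry hR ht j i).hasDerivAt_line_zero m y).hasDerivWithinAt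
  have hf : ∀ j i, HasDerivWithinAt (fun s : ℝ => Torus.partialDeriv l (fun z => R t z j i) (y + Torus.proj (s • v)))
      (Torus.partialDeriv m (Torus.partialDeriv l (fun z => R t z j i)) y) univ 0 := fun j i =>
    (((isSmooth_entry hR ht j i).partialDeriv l).hasDerivAt_line_zero m y).hasDerivWithinAt
  have be : ∀ j i, |(fun s : ℝ => R t (y + Torus.proj (s • v)) j i) 0| ≤ D₀ := fun j i => by
    simp only [line_zero]; exact (abs_entry_le t y j i).trans b0
  have bf : ∀ j i, |(fun s : ℝ => Torus.partialDeriv l (fun z => R t z j i) (y + Torus.proj (s • v))) 0| ≤ D₁ := fun j i => by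
    simp only [line_zero]; exact (abs_partialDeriv_entry_le hR ht l y j i).trans b1l
  have be' : ∀ j i, |Torus.partialDeriv m (fun z => R t z j i) y| ≤ D₁ := fun j i =>
    (abs_partialDeriv_entry_le hR ht m y j i).trans b1m
  have bf' : ∀ j i, |Torus.partialDeriv m (Torus.partialDeriv l (fun z => R t z j i)) y| ≤ D₂ := fun j i =>
    (abs_partialDeriv_partialDeriv_entry_le hR ht m l y j i).trans b2
  have hHS : γ₀ / 4 ≤ α * ((2 / radius d) * Real.sqrt (γ₀ ^ 2 + ∑ i, ∑ j, (fun s : ℝ => R t (y + Torus.proj (s • v)) j i) 0 ^ 2)) +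
      β * (fun s : ℝ => R t (y + Torus.proj (s • v)) j₀ i₀) 0 := by
    simp only [line_zero]
    have hfl := (hsq_bounds (R := R) hd hγ x t y).1
    rw [haff] at hfl
    change γ₀ / 4 ≤ α * rho γ₀ R t y + β * R t y j₀ i₀
    linarith
  obtain ⟨⟨Hl', hHl, hHl'b⟩, -, ⟨A', hA, hA'b⟩⟩ := oneD hγ (radius_pos hd) hα hβ h0 h1 h1 h2 j₀ i₀ he hf be bf be' bf' hHS
  -- identify the path functions with the first derivatives along the line
  have hform := fun s : ℝ => partialDeriv_formulas (x := x) hd hγ hR ht l (y + Torus.proj (s • v)) haff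
  have eqH : (fun s : ℝ => Torus.partialDeriv l (hsq γ₀ R x t) (y + Torus.proj (s • v))) =
      fun s => α * ((1 / radius d) * (∑ i, ∑ j, (Torus.partialDeriv l (fun z => R t z j i) (y + Torus.proj (s • v)) *
        R t (y + Torus.proj (s • v)) j i + R t (y + Torus.proj (s • v)) j i *
        Torus.partialDeriv l (fun z => R t z j i) (y + Torus.proj (s • v)))) /
        Real.sqrt (γ₀ ^ 2 + ∑ i, ∑ j, R t (y + Torus.proj (s • v)) j i ^ 2)) +
      β * Torus.partialDeriv l (fun z => R t z j₀ i₀) (y + Torus.proj (s • v)) := by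
    funext s; rw [(hform s).2.1]; rfl
  have eqA : (fun s : ℝ => Torus.partialDeriv l (jamp γ₀ R x t) (y + Torus.proj (s • v))) =
      fun s => (α * ((1 / radius d) * (∑ i, ∑ j, (Torus.partialDeriv l (fun z => R t z j i) (y + Torus.proj (s • v)) *
        R t (y + Torus.proj (s • v)) j i + R t (y + Torus.proj (s • v)) j i *
        Torus.partialDeriv l (fun z => R t z j i) (y + Torus.proj (s • v)))) /
        Real.sqrt (γ₀ ^ 2 + ∑ i, ∑ j, R t (y + Torus.proj (s • v)) j i ^ 2)) +
      β * Torus.partialDeriv l (fun z => R t z j₀ i₀) (y + Torus.proj (s • v))) /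
      (2 * Real.sqrt (α * ((2 / radius d) * Real.sqrt (γ₀ ^ 2 + ∑ i, ∑ j, R t (y + Torus.proj (s • v)) j i ^ 2)) +
        β * R t (y + Torus.proj (s • v)) j₀ i₀)) := by
    funext s; rw [(hform s).2.2, jamp, haff]; rfl
  constructor
  · have hderiv : HasDerivAt (fun s : ℝ => Torus.partialDeriv l (hsq γ₀ R x t) (y + Torus.proj (s • v))) Hl' 0 := by
      rw [eqH]; exact hasDerivWithinAt_univ.1 hHl
    have : Torus.partialDeriv m (Torus.partialDeriv l (hsq γ₀ R x t)) y = Hl' := hderiv.deriv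
    rw [this]; exact hHl'b
  · have hderiv : HasDerivAt (fun s : ℝ => Torus.partialDeriv l (jamp γ₀ R x t) (y + Torus.proj (s • v))) A' 0 := by
      rw [eqA]; exact hasDerivWithinAt_univ.1 hA
    have : Torus.partialDeriv m (Torus.partialDeriv l (jamp γ₀ R x t)) y = A' := hderiv.deriv
    rw [this]; exact hA'b

include hU

/-- **Mixed time–space derivatives: bounds.** [folklore] -/
theorem timeDerivWithin_partialDeriv_bounds {t : ℝ} (ht : t ∈ S) (l : d) (y : UnitAddTorus d) {D₀ D₁ D₂ : ℝ}
    (h0 : 0 ≤ D₀) (h1 : 0 ≤ D₁) (h2 : 0 ≤ D₂) (b0 : ‖R t y‖ ≤ D₀) (b1l : ‖Torus.partialDeriv l (R t) y‖ ≤ D₁)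
    (b1t : ‖Torus.timeDerivWithin S R t y‖ ≤ D₁)
    (b2 : ‖Torus.timeDerivWithin S (fun s z => Torus.partialDeriv l (R s) z) t y‖ ≤ D₂) :
    |Torus.timeDerivWithin S (fun s z => Torus.partialDeriv l (hsq γ₀ R x s) z) t y| ≤ bh d γ₀ D₀ D₁ D₂ ∧
    |Torus.timeDerivWithin S (fun s z => Torus.partialDeriv l (jamp γ₀ R x s) z) t y| ≤
      bh d γ₀ D₀ D₁ D₂ / Real.sqrt γ₀ + 2 * bh₀ d γ₀ D₀ D₁ * bs d γ₀ D₀ D₁ / (γ₀ * Real.sqrt γ₀) := by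
  obtain ⟨α, β, i₀, j₀, hα, hβ, haff⟩ := hsq_affine (R := R) hd hγ x
  have he : ∀ j i, HasDerivWithinAt (fun s : ℝ => R s y j i) (Torus.timeDerivWithin S (fun s z => R s z j i) t y) S t :=
    fun j i => (isSmoothSpaceTimeOn_apply_apply hR i j).hasDerivWithinAt_slice ht y
  have hf : ∀ j i, HasDerivWithinAt (fun s : ℝ => Torus.partialDeriv l (fun z => R s z j i) y)
      (Torus.timeDerivWithin S (fun s z => Torus.partialDeriv l (fun w => R s w j i) z) t y) S t := fun j i =>
    ((isSmoothSpaceTimeOn_apply_apply hR i j).partialDeriv hU l).hasDerivWithinAt_slice ht y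
  have be : ∀ j i, |(fun s : ℝ => R s y j i) t| ≤ D₀ := fun j i => (abs_entry_le t y j i).trans b0
  have bf : ∀ j i, |(fun s : ℝ => Torus.partialDeriv l (fun z => R s z j i) y) t| ≤ D₁ := fun j i =>
    (abs_partialDeriv_entry_le hR ht l y j i).trans b1l
  have be' : ∀ j i, |Torus.timeDerivWithin S (fun s z => R s z j i) t y| ≤ D₁ := fun j i =>
    (abs_timeDerivWithin_entry_le hR hU ht y j i).trans b1t
  have bf' : ∀ j i, |Torus.timeDerivWithin S (fun s z => Torus.partialDeriv l (fun w => R s w j i) z) t y| ≤ D₂ := fun j i =>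
    (abs_timeDerivWithin_partialDeriv_entry_le hR hU ht l y j i).trans b2
  have hHS : γ₀ / 4 ≤ α * ((2 / radius d) * Real.sqrt (γ₀ ^ 2 + ∑ i, ∑ j, (fun s : ℝ => R s y j i) t ^ 2)) +
      β * (fun s : ℝ => R s y j₀ i₀) t := by
    have hfl := (hsq_bounds (R := R) hd hγ x t y).1
    rw [haff] at hfl
    change γ₀ / 4 ≤ α * rho γ₀ R t y + β * R t y j₀ i₀
    linarith
  obtain ⟨⟨Hl', hHl, hHl'b⟩, -, ⟨A', hA, hA'b⟩⟩ := oneD hγ (radius_pos hd) hα hβ h0 h1 h1 h2 j₀ i₀ he hf be bf be' bf' hHS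
  have hform := fun s (hs : s ∈ S) => partialDeriv_formulas (x := x) hd hγ hR hs l y haff
  constructor
  · have hderiv : HasDerivWithinAt (fun s : ℝ => Torus.partialDeriv l (hsq γ₀ R x s) y) Hl' S t :=
      hHl.congr_of_mem (fun s hs => by rw [(hform s hs).2.1]; rfl) ht
    have : Torus.timeDerivWithin S (fun s z => Torus.partialDeriv l (hsq γ₀ R x s) z) t y = Hl' := hderiv.derivWithin (hU t ht)
    rw [this]; exact hHl'b
  · have hderiv : HasDerivWithinAt (fun s : ℝ => Torus.partialDeriv l (jamp γ₀ R x s) y) A' S t :=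
      hA.congr_of_mem (fun s hs => by rw [(hform s hs).2.2, jamp, haff]; rfl) ht
    have : Torus.timeDerivWithin S (fun s z => Torus.partialDeriv l (jamp γ₀ R x s) z) t y = A' := hderiv.derivWithin (hU t ht)
    rw [this]; exact hA'b

end SecondOrder

/-! ## The package for the iteration -/

section Package

variable (d) in
/-- The amplitude constant (depends on `d` only). [folklore] -/
def ampConst : ℝ :=
  ((1 / radius d) * (4 * (Fintype.card d : ℝ) ^ 2 + 2 * (Fintype.card d : ℝ) ^ 4) + 1) +
    2 * ((1 / radius d) * (2 * (Fintype.card d : ℝ) ^ 2) + 1) ^ 2 + ((1 / radius d) * (2 * (Fintype.card d : ℝ) ^ 2) + 1) +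
    (Real.sqrt (2 / radius d * (1 + Fintype.card d)) + 1)

set_option maxHeartbeats 1600000 in
/-- **The amplitude package.** For a stress field `R` jointly smooth on a time set `S` (with unique
derivatives), a floor `γ₀ > 0`, and sup bounds on `S × 𝕋^d`
`‖R‖ ≤ D₀ ≤ γ₀Y`, `‖∂R‖, ‖∂ₜR‖ ≤ D₁ ≤ γ₀YΘ`, `‖∂∂R‖, ‖∂ₜ∂R‖ ≤ D₂ ≤ γ₀YΘ²` (`Y, Θ ≥ 1`), the amplitudes
`a_x = jamp γ₀ R x` and their squares `hsq` satisfy, with `C = ampConst d`: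
`0 ≤ a_x ≤ C(γ₀Y)^{1/2}`, `|∂a_x|, |∂ₜa_x| ≤ Cγ₀^{1/2}Y²Θ`, `|∂∂a_x|, |∂ₜ∂a_x| ≤ Cγ₀^{1/2}Y⁴Θ²`,
`|∂hsq_x|, |∂ₜhsq_x| ≤ Cγ₀Y²Θ`, `|∂∂hsq_x|, |∂ₜ∂hsq_x| ≤ Cγ₀Y⁴Θ²` (Buckmaster–Vicol (7.29):
`‖a_ξ‖_{C^N_{x,t}} ≲ ℓ^{-c N} δ^{1/2}`, here with the explicit polynomial dependence needed along the
iteration). [cite: BuckmasterVicol2020, §7.5.1 (7.29)] -/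
theorem jamp_package (hd : 2 ≤ Fintype.card d) (hγ : 0 < γ₀) {S : Set ℝ} (hR : Torus.IsSmoothSpaceTimeOn S R)
    (hU : UniqueDiffOn ℝ S) {Y Θ D₀ D₁ D₂ : ℝ} (hY : 1 ≤ Y) (hΘ : 1 ≤ Θ) (h0 : 0 ≤ D₀) (h1 : 0 ≤ D₁) (h2 : 0 ≤ D₂)
    (hD₀ : D₀ ≤ γ₀ * Y) (hD₁ : D₁ ≤ γ₀ * Y * Θ) (hD₂ : D₂ ≤ γ₀ * Y * Θ ^ 2)
    (b0 : ∀ t ∈ S, ∀ y, ‖R t y‖ ≤ D₀) (b1 : ∀ t ∈ S, ∀ y l, ‖Torus.partialDeriv l (R t) y‖ ≤ D₁)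
    (b1t : ∀ t ∈ S, ∀ y, ‖Torus.timeDerivWithin S R t y‖ ≤ D₁)
    (b2 : ∀ t ∈ S, ∀ y l m, ‖Torus.partialDeriv m (Torus.partialDeriv l (R t)) y‖ ≤ D₂)
    (b2t : ∀ t ∈ S, ∀ y l, ‖Torus.timeDerivWithin S (fun s z => Torus.partialDeriv l (R s) z) t y‖ ≤ D₂)
    (x : Index d) {t : ℝ} (ht : t ∈ S) (y : UnitAddTorus d) (l m : d) :
    (0 ≤ jamp γ₀ R x t y ∧ jamp γ₀ R x t y ≤ ampConst d * Real.sqrt (γ₀ * Y)) ∧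
    |Torus.partialDeriv l (jamp γ₀ R x t) y| ≤ ampConst d * Real.sqrt γ₀ * Y ^ 2 * Θ ∧
    |Torus.timeDerivWithin S (jamp γ₀ R x) t y| ≤ ampConst d * Real.sqrt γ₀ * Y ^ 2 * Θ ∧
    |Torus.partialDeriv m (Torus.partialDeriv l (jamp γ₀ R x t)) y| ≤ ampConst d * Real.sqrt γ₀ * Y ^ 4 * Θ ^ 2 ∧
    |Torus.timeDerivWithin S (fun s z => Torus.partialDeriv l (jamp γ₀ R x s) z) t y| ≤ ampConst d * Real.sqrt γ₀ * Y ^ 4 * Θ ^ 2 ∧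
    |Torus.partialDeriv l (hsq γ₀ R x t) y| ≤ ampConst d * γ₀ * Y ^ 2 * Θ ∧
    |Torus.timeDerivWithin S (hsq γ₀ R x) t y| ≤ ampConst d * γ₀ * Y ^ 2 * Θ ∧
    |Torus.partialDeriv m (Torus.partialDeriv l (hsq γ₀ R x t)) y| ≤ ampConst d * γ₀ * Y ^ 4 * Θ ^ 2 ∧
    |Torus.timeDerivWithin S (fun s z => Torus.partialDeriv l (hsq γ₀ R x s) z) t y| ≤ ampConst d * γ₀ * Y ^ 4 * Θ ^ 2 := by
  have hr := radius_pos hd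
  set cd : ℝ := (Fintype.card d : ℝ) ^ 2 with hcd
  have hcd0 : 0 ≤ cd := by positivity
  -- the four named constants
  set K₂ : ℝ := (1 / radius d) * (4 * cd + 2 * cd ^ 2) + 1 with hK₂
  set K₃ : ℝ := (1 / radius d) * (2 * cd) + 1 with hK₃
  set A₀ : ℝ := Real.sqrt (2 / radius d * (1 + Fintype.card d)) + 1 with hA₀
  have hK₂0 : 0 ≤ K₂ := by positivity
  have hK₃1 : 1 ≤ K₃ := by
    have : 0 ≤ (1 / radius d) * (2 * cd) := by positivity
    rw [hK₃]; linarith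
  have hA₀0 : 0 ≤ A₀ := by positivity
  have hC : ampConst d = K₂ + 2 * K₃ ^ 2 + K₃ + A₀ := by
    simp only [ampConst, hK₂, hK₃, hA₀, hcd]; ring
  have hCK₂ : K₂ ≤ ampConst d := by rw [hC]; nlinarith
  have hCK₃ : K₃ ≤ ampConst d := by rw [hC]; nlinarith
  have hC2 : K₂ + 2 * K₃ ^ 2 ≤ ampConst d := by rw [hC]; nlinarith
  have hCA : A₀ ≤ ampConst d := by rw [hC]; nlinarith
  have hγ0 := hγ.le
  have hsγ : 0 < Real.sqrt γ₀ := Real.sqrt_pos.2 hγ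
  have hY0 : 0 ≤ Y := by linarith
  have hΘ0 : 0 ≤ Θ := by linarith
  have hY2 : Y ≤ Y ^ 2 := by nlinarith
  have hΘ2 : Θ ≤ Θ ^ 2 := by nlinarith
  -- products of the data bounds
  have p01 : D₀ * D₁ ≤ γ₀ ^ 2 * Y ^ 2 * Θ := by
    calc D₀ * D₁ ≤ (γ₀ * Y) * (γ₀ * Y * Θ) := mul_le_mul hD₀ hD₁ h1 (by positivity)
      _ = γ₀ ^ 2 * Y ^ 2 * Θ := by ring
  have p11 : D₁ * D₁ ≤ γ₀ ^ 2 * Y ^ 2 * Θ ^ 2 := by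
    calc D₁ * D₁ ≤ (γ₀ * Y * Θ) * (γ₀ * Y * Θ) := mul_le_mul hD₁ hD₁ h1 (by positivity)
      _ = γ₀ ^ 2 * Y ^ 2 * Θ ^ 2 := by ring
  have p02 : D₀ * D₂ ≤ γ₀ ^ 2 * Y ^ 2 * Θ ^ 2 := by
    calc D₀ * D₂ ≤ (γ₀ * Y) * (γ₀ * Y * Θ ^ 2) := mul_le_mul hD₀ hD₂ h2 (by positivity)
      _ = γ₀ ^ 2 * Y ^ 2 * Θ ^ 2 := by ring
  -- the first-order expression
  have hF₁ : (1 / radius d) * (cd * (2 * D₀ * D₁)) / γ₀ / 2 + D₁ ≤ K₃ * γ₀ * Y ^ 2 * Θ := by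
    have e1 : (1 / radius d) * (cd * (2 * D₀ * D₁)) / γ₀ / 2 = (1 / radius d) * cd * (D₀ * D₁) / γ₀ := by field_simp
    rw [e1]
    have a1 : (1 / radius d) * cd * (D₀ * D₁) / γ₀ ≤ (1 / radius d) * cd * (γ₀ * Y ^ 2 * Θ) := by
      rw [div_le_iff₀ hγ]
      have : (1 / radius d) * cd * (D₀ * D₁) ≤ (1 / radius d) * cd * (γ₀ ^ 2 * Y ^ 2 * Θ) :=
        mul_le_mul_of_nonneg_left p01 (by positivity)
      nlinarith
    have a2 : D₁ ≤ γ₀ * Y ^ 2 * Θ := hD₁.trans (by nlinarith [mul_le_mul_of_nonneg_left hY2 (by positivity : 0 ≤ γ₀ * Θ)])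
    calc (1 / radius d) * cd * (D₀ * D₁) / γ₀ + D₁ ≤ (1 / radius d) * cd * (γ₀ * Y ^ 2 * Θ) + γ₀ * Y ^ 2 * Θ := add_le_add a1 a2
      _ ≤ K₃ * γ₀ * Y ^ 2 * Θ := by
          rw [hK₃]
          have : 0 ≤ (1 / radius d) * cd * (γ₀ * Y ^ 2 * Θ) := by positivity
          nlinarith
  -- the second-order expressions
  have hBh : bh d γ₀ D₀ D₁ D₂ ≤ K₂ * γ₀ * Y ^ 4 * Θ ^ 2 := by
    simp only [bh, ← hcd]
    have a1 : cd * (2 * (D₁ * D₁ + D₀ * D₂)) / γ₀ ≤ 4 * cd * γ₀ * Y ^ 2 * Θ ^ 2 := by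
      rw [div_le_iff₀ hγ]; nlinarith [mul_le_mul_of_nonneg_left (add_le_add p11 p02) hcd0]
    have a2 : (cd * (2 * D₀ * D₁)) * (cd * (D₀ * D₁) / γ₀) / γ₀ ^ 2 ≤ 2 * cd ^ 2 * γ₀ * Y ^ 4 * Θ ^ 2 := by
      have e2 : (cd * (2 * D₀ * D₁)) * (cd * (D₀ * D₁) / γ₀) / γ₀ ^ 2 = 2 * cd ^ 2 * (D₀ * D₁) ^ 2 / γ₀ ^ 3 := by
        field_simp
      rw [e2, div_le_iff₀ (by positivity)]
      have hp : (D₀ * D₁) ^ 2 ≤ (γ₀ ^ 2 * Y ^ 2 * Θ) ^ 2 := pow_le_pow_left₀ (by positivity) p01 2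
      have hΘ4 : Θ ^ 2 ≤ Θ ^ 2 * 1 := by ring_nf; rfl
      nlinarith [mul_le_mul_of_nonneg_left hp (by positivity : (0:ℝ) ≤ 2 * cd ^ 2),
        mul_le_mul_of_nonneg_left hΘ2 (by positivity : (0:ℝ) ≤ 2 * cd ^ 2 * γ₀ ^ 4 * Y ^ 4)]
    have a3 : D₂ ≤ γ₀ * Y ^ 4 * Θ ^ 2 := hD₂.trans (by
      have hY4 : Y ≤ Y ^ 4 := by nlinarith
      nlinarith [mul_le_mul_of_nonneg_left hY4 (by positivity : 0 ≤ γ₀ * Θ ^ 2)])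
    have hY24 : Y ^ 2 ≤ Y ^ 4 := by nlinarith
    calc (1 / radius d) * (cd * (2 * (D₁ * D₁ + D₀ * D₂)) / γ₀ + (cd * (2 * D₀ * D₁)) * (cd * (D₀ * D₁) / γ₀) / γ₀ ^ 2) + D₂
        ≤ (1 / radius d) * (4 * cd * γ₀ * Y ^ 2 * Θ ^ 2 + 2 * cd ^ 2 * γ₀ * Y ^ 4 * Θ ^ 2) + γ₀ * Y ^ 4 * Θ ^ 2 := by
          gcongr
      _ ≤ (1 / radius d) * (4 * cd * γ₀ * Y ^ 4 * Θ ^ 2 + 2 * cd ^ 2 * γ₀ * Y ^ 4 * Θ ^ 2) + γ₀ * Y ^ 4 * Θ ^ 2 := by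
          gcongr
      _ = K₂ * γ₀ * Y ^ 4 * Θ ^ 2 := by rw [hK₂]; ring
  have hBh₀ : bh₀ d γ₀ D₀ D₁ ≤ K₃ * γ₀ * Y ^ 2 * Θ := by
    simp only [bh₀, ← hcd]
    have a1 : (1 / radius d) * (cd * (2 * D₀ * D₁)) / γ₀ ≤ (1 / radius d) * (2 * cd) * (γ₀ * Y ^ 2 * Θ) := by
      rw [div_le_iff₀ hγ]
      have : (1 / radius d) * (cd * (2 * D₀ * D₁)) = (1 / radius d) * (2 * cd) * (D₀ * D₁) := by ring
      rw [this]
      nlinarith [mul_le_mul_of_nonneg_left p01 (by positivity : (0:ℝ) ≤ (1 / radius d) * (2 * cd))]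
    have a2 : D₁ ≤ γ₀ * Y ^ 2 * Θ := hD₁.trans (by nlinarith [mul_le_mul_of_nonneg_left hY2 (by positivity : 0 ≤ γ₀ * Θ)])
    calc (1 / radius d) * (cd * (2 * D₀ * D₁)) / γ₀ + D₁ ≤ (1 / radius d) * (2 * cd) * (γ₀ * Y ^ 2 * Θ) + γ₀ * Y ^ 2 * Θ :=
          add_le_add a1 a2
      _ = K₃ * γ₀ * Y ^ 2 * Θ := by rw [hK₃]; ring
  have hBS : bs d γ₀ D₀ D₁ ≤ K₃ * γ₀ * Y ^ 2 * Θ := by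
    refine le_trans ?_ hBh₀
    simp only [bs, bh₀, ← hcd]
    have : (1 / radius d) * (cd * (D₀ * D₁) / γ₀) ≤ (1 / radius d) * (cd * (2 * D₀ * D₁)) / γ₀ := by
      have e1 : (1 / radius d) * (cd * (2 * D₀ * D₁)) / γ₀ = (1 / radius d) * (cd * (2 * D₀ * D₁) / γ₀) := by ring
      rw [e1]
      refine mul_le_mul_of_nonneg_left (div_le_div_of_nonneg_right ?_ hγ0) (by positivity)
      nlinarith [mul_nonneg h0 h1]
    linarith
  have hSecond : bh d γ₀ D₀ D₁ D₂ / Real.sqrt γ₀ + 2 * bh₀ d γ₀ D₀ D₁ * bs d γ₀ D₀ D₁ / (γ₀ * Real.sqrt γ₀) ≤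
      (K₂ + 2 * K₃ ^ 2) * Real.sqrt γ₀ * Y ^ 4 * Θ ^ 2 := by
    have hbh0' : 0 ≤ bh₀ d γ₀ D₀ D₁ := by simp only [bh₀]; positivity
    have hbs0' : 0 ≤ bs d γ₀ D₀ D₁ := by simp only [bs]; positivity
    have a1 : bh d γ₀ D₀ D₁ D₂ / Real.sqrt γ₀ ≤ K₂ * Real.sqrt γ₀ * Y ^ 4 * Θ ^ 2 := by
      rw [div_le_iff₀ hsγ]
      calc bh d γ₀ D₀ D₁ D₂ ≤ K₂ * γ₀ * Y ^ 4 * Θ ^ 2 := hBh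
        _ = K₂ * Real.sqrt γ₀ * Y ^ 4 * Θ ^ 2 * Real.sqrt γ₀ := by
            rw [show K₂ * Real.sqrt γ₀ * Y ^ 4 * Θ ^ 2 * Real.sqrt γ₀ = K₂ * (Real.sqrt γ₀ * Real.sqrt γ₀) * Y ^ 4 * Θ ^ 2 by ring,
              Real.mul_self_sqrt hγ0]
    have a2 : 2 * bh₀ d γ₀ D₀ D₁ * bs d γ₀ D₀ D₁ / (γ₀ * Real.sqrt γ₀) ≤ 2 * K₃ ^ 2 * Real.sqrt γ₀ * Y ^ 4 * Θ ^ 2 := by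
      rw [div_le_iff₀ (by positivity)]
      have hp : bh₀ d γ₀ D₀ D₁ * bs d γ₀ D₀ D₁ ≤ (K₃ * γ₀ * Y ^ 2 * Θ) * (K₃ * γ₀ * Y ^ 2 * Θ) :=
        mul_le_mul hBh₀ hBS hbs0' (by positivity)
      calc 2 * bh₀ d γ₀ D₀ D₁ * bs d γ₀ D₀ D₁ ≤ 2 * ((K₃ * γ₀ * Y ^ 2 * Θ) * (K₃ * γ₀ * Y ^ 2 * Θ)) := by nlinarith
        _ = 2 * K₃ ^ 2 * Real.sqrt γ₀ * Y ^ 4 * Θ ^ 2 * (γ₀ * Real.sqrt γ₀) := by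
            have : Real.sqrt γ₀ * Real.sqrt γ₀ = γ₀ := Real.mul_self_sqrt hγ0
            nlinarith [this]
    calc _ ≤ K₂ * Real.sqrt γ₀ * Y ^ 4 * Θ ^ 2 + 2 * K₃ ^ 2 * Real.sqrt γ₀ * Y ^ 4 * Θ ^ 2 := add_le_add a1 a2
      _ = (K₂ + 2 * K₃ ^ 2) * Real.sqrt γ₀ * Y ^ 4 * Θ ^ 2 := by ring
  -- the bounds
  have b1' := b1 t ht y
  obtain ⟨-, s1h, s1a⟩ := partialDeriv_bounds (x := x) hd hγ hR ht l y h1 (b0 t ht y) (b1 t ht y l)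
  obtain ⟨-, t1h, t1a⟩ := timeDerivWithin_bounds (x := x) hd hγ hR hU ht y h1 (b0 t ht y) (b1t t ht y)
  obtain ⟨s2h, s2a⟩ := partialDeriv_partialDeriv_bounds (x := x) hd hγ hR ht m l y h0 h1 h2 (b0 t ht y) (b1 t ht y l) (b1 t ht y m)
    (b2 t ht y l m)
  obtain ⟨t2h, t2a⟩ := timeDerivWithin_partialDeriv_bounds (x := x) hd hγ hR hU ht l y h0 h1 h2 (b0 t ht y) (b1 t ht y l)
    (b1t t ht y) (b2t t ht y l)
  have hF₁' : ((1 / radius d) * (cd * (2 * D₀ * D₁)) / γ₀ / 2 + D₁) / Real.sqrt γ₀ ≤ K₃ * Real.sqrt γ₀ * Y ^ 2 * Θ := by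
    rw [div_le_iff₀ hsγ]
    calc _ ≤ K₃ * γ₀ * Y ^ 2 * Θ := hF₁
      _ = K₃ * Real.sqrt γ₀ * Y ^ 2 * Θ * Real.sqrt γ₀ := by
          rw [show K₃ * Real.sqrt γ₀ * Y ^ 2 * Θ * Real.sqrt γ₀ = K₃ * (Real.sqrt γ₀ * Real.sqrt γ₀) * Y ^ 2 * Θ by ring,
            Real.mul_self_sqrt hγ0]
  have mono1 : K₃ * Real.sqrt γ₀ * Y ^ 2 * Θ ≤ ampConst d * Real.sqrt γ₀ * Y ^ 2 * Θ := by gcongr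
  have mono2 : (K₂ + 2 * K₃ ^ 2) * Real.sqrt γ₀ * Y ^ 4 * Θ ^ 2 ≤ ampConst d * Real.sqrt γ₀ * Y ^ 4 * Θ ^ 2 := by gcongr
  have mono3 : K₃ * γ₀ * Y ^ 2 * Θ ≤ ampConst d * γ₀ * Y ^ 2 * Θ := by gcongr
  have mono4 : K₂ * γ₀ * Y ^ 4 * Θ ^ 2 ≤ ampConst d * γ₀ * Y ^ 4 * Θ ^ 2 := by gcongr
  refine ⟨⟨(jamp_sq hd hγ x t y).2.1, ?_⟩, (s1a.trans hF₁').trans mono1, (t1a.trans hF₁').trans mono1,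
    (s2a.trans hSecond).trans mono2, (t2a.trans hSecond).trans mono2, (s1h.trans hF₁).trans mono3, (t1h.trans hF₁).trans mono3,
    (s2h.trans hBh).trans mono4, (t2h.trans hBh).trans mono4⟩
  -- the sup bound `a ≤ √ρ ≤ √((2/r)(γ₀ + d D₀)) ≤ A₀ √(γ₀ Y)`
  have hρ := rho_le_norm (R := R) hd hγ t y
  calc jamp γ₀ R x t y ≤ Real.sqrt (rho γ₀ R t y) := (jamp_sq hd hγ x t y).2.2
    _ ≤ Real.sqrt (2 / radius d * (γ₀ + Fintype.card d * ‖R t y‖)) := Real.sqrt_le_sqrt hρ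
    _ ≤ Real.sqrt (2 / radius d * (1 + Fintype.card d) * (γ₀ * Y)) := by
        refine Real.sqrt_le_sqrt ?_
        have a1 : ‖R t y‖ ≤ γ₀ * Y := (b0 t ht y).trans hD₀
        have a2 : γ₀ ≤ γ₀ * Y := by nlinarith
        have : (Fintype.card d : ℝ) * ‖R t y‖ ≤ Fintype.card d * (γ₀ * Y) := mul_le_mul_of_nonneg_left a1 (by positivity)
        have e1 : 2 / radius d * (1 + Fintype.card d) * (γ₀ * Y) = 2 / radius d * (γ₀ * Y + Fintype.card d * (γ₀ * Y)) := by ring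
        rw [e1]
        exact mul_le_mul_of_nonneg_left (by linarith) (by positivity)
    _ = Real.sqrt (2 / radius d * (1 + Fintype.card d)) * Real.sqrt (γ₀ * Y) := Real.sqrt_mul (by positivity) _
    _ ≤ ampConst d * Real.sqrt (γ₀ * Y) := by
        refine mul_le_mul_of_nonneg_right (le_trans (by linarith) hCA) (Real.sqrt_nonneg _)

end Package

end JAmp

end Literature.Analysis.FluidPDE
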